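import Mathlib.RingTheory.Polynomial.Resultant.Basic
import Mathlib.RingTheory.Polynomial.GaussLemma
import Mathlib.RingTheory.Polynomial.UniqueFactorization
import Mathlib.RingTheory.MvPolynomial.Homogeneous
import Mathlib.Algebra.MvPolynomial.PDeriv
import Mathlib.Algebra.MvPolynomial.Equiv
import Mathlib.Algebra.MvPolynomial.NoZeroDivisors
import Mathlib.Algebra.MvPolynomial.Funext
import Mathlib.Algebra.Polynomial.Derivative
import Mathlib.Algebra.Polynomial.BigOperators
import Mathlib.Algebra.Polynomial.Degree.Lemmas
import Mathlib.FieldTheory.Separable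
import Mathlib.FieldTheory.IsAlgClosed.AlgebraicClosure
import Mathlib.RingTheory.Localization.FractionRing
import Mathlib.Logic.Equiv.Set
import Literature.RingTheory.NoetherNormalization.LinearChange
import Literature.NumberTheory.DiophantineGeometry.BertiniDirectionProofs
import Literature.NumberTheory.DiophantineGeometry.BertiniSpecializationProofs
import Literature.NumberTheory.DiophantineGeometry.BertiniSubstitutionProofs
import Literature.RingTheory.MvPolynomial.AbsoluteIrreducibilityReduction
import HarnessLib

/-!
# Kaltofen's effective first Bertini theorem (fibrewise form): proofs

This file PROVES the named fact `kaltofen1995_effectiveBertini` of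
`AbsoluteIrreducibilityReduction.lean` (`kaltofen1995_effectiveBertini_holds`): E. Kaltofen,
*Effective Noether irreducibility forms and applications*, J. Comput. System Sci. 50 (1995)
274–295 [`Kaltofen1995`], §4 "Effective Hilbert Irreducibility", **Lemma 4 + Theorem 5**, in the
fibrewise form printed there and quoted by Cafure–Matera 2006, §3.2 [`CafureMatera2006`]: for
`f ∈ K[x₀, …, xₙ]` (`1 ≤ n`) absolutely irreducible of total degree `δ ≥ 2` there is
`0 ≠ Υ ∈ K[v, w]`, `deg Υ ≤ 2δ²`, and for every `(ν, ω) ∈ K̄^{2n+1}` with `Υ(ν, ω) ≠ 0` a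
`0 ≠ Ψ ∈ K̄[z₁, …, zₙ]` with `2 deg Ψ + 4δ³ ≤ 3δ⁴ + δ²` such that
`Ψ(η) ≠ 0 ⟹ f(X + ν₀, ω₁X + η₁Y + ν₁, …, ωₙX + ηₙY + νₙ) ∈ K̄[X, Y]` is irreducible.

## The printed proof and this formalisation

* **(30), Lemmas 2–4 (`kaltofen1995_lemma4`).** `Υ` is the resultant (formal degrees `δ, δ − 1`)
  of the GENERIC line restriction `φ = f(v₀ + X, v₁ + w₁X, …, vₙ + wₙX) ∈ K[v, w][X]` and its
  `X`-derivative (`upsilon`; Kaltofen takes `l · l^{2d−1} r`, the same polynomial up to the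
  normalisation by the generic leading coefficient `l`). Its leading coefficient is the dehomogenised
  top component `f_δ(1, w) ≠ 0` ((30); `coeff_genLine_totalDegree`, via
  `NoetherNormalization.dehomTop`); `φ` is irreducible (Lemma 2: the substitution is an automorphism
  of `K̄[X, v, w]`, `irreducible_genLine`); hence (Lemma 3) `Υ ≠ 0`: otherwise `φ` and `∂φ/∂X` are
  not coprime over `Frac K̄[v, w]` (`Polynomial.resultant_eq_zero_iff`), so by Gauss's lemma
  `φ ∣ ∂φ/∂X`, i.e. `∂φ/∂X = 0`, i.e. (chain rule + the retraction `X ↦ 0, v ↦ x, w ↦ ω`) all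
  partials of `f` vanish, impossible for an irreducible `f` over `K̄` (Case 1 of Lemma 3;
  `exists_pderiv_ne_zero` of `BertiniDirectionProofs`). `deg Υ ≤ (2δ − 1)δ ≤ 2δ²` by a row count of
  the Sylvester determinant (Lemma 4), and `Υ(ν, ω) ≠ 0` gives condition (33): the line restriction
  `χ(x, 0, ·) = f(X + ν₀, ω₁X + ν₁, …)` has degree `δ` and is separable
  (`natDegree_eq_and_separable_of_aeval_upsilon_ne_zero`).
* **Lemma 5 + Theorem 5 (`kaltofen1995_thm5_fibre`).** The Newton–Hensel / linear-system / maximal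
  minor argument is the tree's abstract `exists_irreducibility_certificate`
  (`Literature/NumberTheory/DiophantineGeometry/BertiniSpecializationProofs.lean` and its siblings
  `Bertini{Newton,Resultant,Minor,LocalIrreducibility,Shape,Substitution,Homogenization}Proofs`),
  re-run here with Kaltofen's two sharper counts so as to reach the PRINTED bound
  `deg Ψ ≤ ∑_{j<δ²} (2δ(δ−1) − j) = 3δ⁴/2 − 2δ³ + δ²/2` (`exists_irreducibility_certificate_sharp`):
  the order of approximation `ℓ = 2δ(δ − 1)` (the resultant `Res_X(χ, h)` has `Y`-degree
  `≤ (δ−1)·δ + δ·(δ−1)`, `IsSubdegree.resultant_le_two_weights`, `eq_zero_of_pow_dvd_eval₂`) and the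
  degree of a maximal minor as a sum of DISTINCT row indices (`sum_val_le_of_injective`,
  `kaltofen_degree_count`). The certificate is applied to the plane section through the line
  `ν + X(1, ω)` with ALL `n + 1` coordinates sheared, `f(ν₀ + X + z₀Y, νᵢ + ωᵢX + zᵢY)`
  (irreducible by `irreducible_planeSubst` = Kaltofen's Lemma 5, shape lemmas of
  `BertiniShapeProofs`); `Ψ` is the leading `z₀`-coefficient of the certificate sheared by
  `z ↦ z + ωz₀` (`NoetherNormalization.linearChange`, `exists_coeff_certificate`), and the
  substitution `X ↦ X − γ₀Y` turns a certified section into `planeSection f ν ω η`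
  (`transport_planeSection`).

## Generic tools proved here ([folklore])

`IsSubdegree` (sub-degree functions; determinant and coefficientwise bounds), linear
substitutions `xᵢ ↦ bᵢ + aᵢX` (degree, top coefficient, chain rule), irreducibility under adjoining
variables (`irreducible_rename_of_injective`), `sum_le_of_subset_range`.

## References

* E. Kaltofen, J. Comput. System Sci. 50 (1995) 274–295, §2 (systems (2), (5), order
  `ℓ = deg_y(f)(m + d − 1)`), §4 (30)–(33), Lemmas 2–5, Theorem 5 and its proof with the count
  `d(2d−2)d² − (d²−1)d²/2` (read: PDF pp. 5–10, 18–22). [`Kaltofen1995`]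
* A. Cafure, G. Matera, Finite Fields Appl. 12 (2006) 155–185, §3.2. [`CafureMatera2006`]
-/

noncomputable section

open Finset Matrix
open scoped BigOperators Polynomial

namespace Literature.RingTheory.MvPolynomial

namespace Kaltofen1995

/-! ### Degree bookkeeping for determinants and resultants -/

section DetDegree

variable {ι R : Type*} [Fintype ι] [DecidableEq ι] [CommRing R]

/-- A "sub-degree" function on a commutative ring: `D 0 = D 1 = 0`, `D (a + b) ≤ max`,
`D (a b) ≤ D a + D b`, `D (−a) = D a` (e.g. `natDegree`, `totalDegree`). [folklore] -/
structure IsSubdegree (D : R → ℕ) : Prop where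
  zero : D 0 = 0
  one : D 1 = 0
  add : ∀ a b, D (a + b) ≤ max (D a) (D b)
  mul : ∀ a b, D (a * b) ≤ D a + D b
  neg : ∀ a, D (-a) = D a

variable {D : R → ℕ}

/-- A sum of elements of sub-degree `≤ B` has sub-degree `≤ B`. [folklore] -/
theorem IsSubdegree.sum_le (hD : IsSubdegree D) {α : Type*} (s : Finset α) (f : α → R) (B : ℕ)
    (h : ∀ a ∈ s, D (f a) ≤ B) : D (∑ a ∈ s, f a) ≤ B := by
  classical
  induction s using Finset.induction_on with
  | empty => simp [hD.zero]
  | insert a s ha ih =>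
    rw [Finset.sum_insert ha]
    refine (hD.add _ _).trans (max_le (h a (by simp)) (ih fun b hb => h b (by simp [hb])))

/-- Sub-degree of a product is at most the sum of the sub-degrees. [folklore] -/
theorem IsSubdegree.prod_le (hD : IsSubdegree D) {α : Type*} (s : Finset α) (f : α → R) :
    D (∏ a ∈ s, f a) ≤ ∑ a ∈ s, D (f a) := by
  classical
  induction s using Finset.induction_on with
  | empty => simp [hD.one]
  | insert a s ha ih =>
    rw [Finset.prod_insert ha, Finset.sum_insert ha]
    exact (hD.mul _ _).trans (by omega)

/-- Sub-degrees are invariant under `±1`. [folklore] -/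
theorem IsSubdegree.units_smul (hD : IsSubdegree D) (u : ℤˣ) (a : R) : D (u • a) = D a := by
  rcases Int.units_eq_one_or u with rfl | rfl
  · simp
  · simp [Units.smul_def, hD.neg]

/-- Row-wise degree bound for determinants: if every entry of row `i` has sub-degree `≤ r i`,
then `D (det A) ≤ ∑ i, r i`. [folklore] -/
theorem IsSubdegree.det_le (hD : IsSubdegree D) (A : Matrix ι ι R) (r : ι → ℕ)
    (hA : ∀ i j, D (A i j) ≤ r i) : D A.det ≤ ∑ i, r i := by
  rw [Matrix.det_apply]
  refine hD.sum_le _ _ _ fun σ _ => ?_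
  rw [hD.units_smul]
  refine (hD.prod_le _ _).trans ?_
  calc ∑ i, D (A (σ i) i) ≤ ∑ i, r (σ i) := Finset.sum_le_sum fun i _ => hA _ _
    _ = ∑ i, r i := Equiv.sum_comp σ r

/-- `Polynomial.natDegree` is a sub-degree. [folklore] -/
theorem isSubdegree_natDegree {S : Type*} [CommRing S] :
    IsSubdegree (Polynomial.natDegree : Polynomial S → ℕ) where
  zero := Polynomial.natDegree_zero
  one := Polynomial.natDegree_one
  add := Polynomial.natDegree_add_le
  mul := fun _ _ => Polynomial.natDegree_mul_le
  neg := Polynomial.natDegree_neg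

/-- `MvPolynomial.totalDegree` is a sub-degree. [folklore] -/
theorem isSubdegree_totalDegree {σ S : Type*} [CommRing S] :
    IsSubdegree (MvPolynomial.totalDegree : MvPolynomial σ S → ℕ) where
  zero := MvPolynomial.totalDegree_zero
  one := MvPolynomial.totalDegree_one
  add := MvPolynomial.totalDegree_add
  mul := MvPolynomial.totalDegree_mul
  neg := fun a => MvPolynomial.totalDegree_neg a

end DetDegree


/-! ### Linear substitutions `xᵢ ↦ bᵢ + aᵢ X` -/

section TopCoeff

open Polynomial Literature.RingTheory.NoetherNormalization

variable {R A σ : Type*} [CommRing R] [CommRing A] [Algebra R A] [Fintype σ]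

/-- A linear substitution `xᵢ ↦ bᵢ + aᵢ X` raises the `X`-degree to at most the total degree.
[folklore] -/
theorem natDegree_aeval_linear_le (a b : σ → A) (f : MvPolynomial σ R) :
    (MvPolynomial.aeval (fun i => C (b i) + C (a i) * X) f).natDegree ≤ f.totalDegree := by
  rw [MvPolynomial.aeval_def, MvPolynomial.eval₂_eq']
  refine Polynomial.natDegree_sum_le_of_forall_le _ _ fun d hd => ?_
  refine (natDegree_mul_le).trans ?_
  rw [Polynomial.algebraMap_apply, natDegree_C, zero_add]
  refine (natDegree_prod_pow_le _ _ _ fun i _ => natDegree_C_add_C_mul_X_le _ _).trans ?_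
  calc ∑ i, d i = d.sum fun _ e => e := (Finsupp.sum_fintype d (fun _ e => e) (fun _ => rfl)).symm
    _ ≤ f.totalDegree := MvPolynomial.le_totalDegree hd

/-- The coefficient of `X^δ`, `δ = deg f`, after a linear substitution `xᵢ ↦ bᵢ + aᵢ X` is the
top homogeneous component `f_δ` of `f` evaluated at the slopes `a` (Kaltofen's (30):
`ldcf_x f(x + v₁, y + w x + v) = ∑_{|e| = d} q_e w^e`). [cite: Kaltofen1995, §4 (30)] -/
theorem coeff_aeval_linear_totalDegree (a b : σ → A) (f : MvPolynomial σ R) :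
    (MvPolynomial.aeval (fun i => C (b i) + C (a i) * X) f).coeff f.totalDegree =
      MvPolynomial.aeval a (MvPolynomial.homogeneousComponent f.totalDegree f) := by
  classical
  set δ := f.totalDegree with hδ
  rw [MvPolynomial.aeval_def, MvPolynomial.eval₂_eq', Polynomial.finsetSum_coeff,
    MvPolynomial.homogeneousComponent_apply, map_sum, Finset.sum_filter]
  refine Finset.sum_congr rfl fun d hd => ?_
  have hdeg : (d.degree = δ) ↔ (∑ i, d i = δ) := by
    rw [Finsupp.degree_eq_sum]
  have hle : ∑ i, d i ≤ δ := by
    rw [← Finsupp.sum_fintype d (fun _ e => e) (fun _ => rfl)]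
    exact MvPolynomial.le_totalDegree hd
  rw [Polynomial.algebraMap_apply, Polynomial.coeff_C_mul]
  by_cases h : ∑ i, d i = δ
  · rw [if_pos (hdeg.mpr h), ← h,
      coeff_prod_pow_sum _ _ _ fun i _ => natDegree_C_add_C_mul_X_le _ _,
      MvPolynomial.aeval_monomial, Finsupp.prod_fintype _ _ (by simp)]
    congr 1
    exact Finset.prod_congr rfl fun i _ => by rw [coeff_C_add_C_mul_X_one]
  · rw [if_neg (fun h' => h (hdeg.mp h')), Polynomial.coeff_eq_zero_of_natDegree_lt, mul_zero]
    exact lt_of_le_of_lt (natDegree_prod_pow_le _ _ _ fun i _ => natDegree_C_add_C_mul_X_le _ _)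
      (lt_of_le_of_ne hle h)

variable [DecidableEq σ]

/-- Chain rule for a linear substitution `xᵢ ↦ bᵢ + aᵢ X`:
`d/dX f(b + aX) = ∑ᵢ aᵢ · (∂f/∂xᵢ)(b + aX)`. [folklore] -/
theorem derivative_aeval_linear (a b : σ → A) (f : MvPolynomial σ R) :
    derivative (MvPolynomial.aeval (fun i => C (b i) + C (a i) * X) f) =
      ∑ i, C (a i) * MvPolynomial.aeval (fun i => C (b i) + C (a i) * X)
        (MvPolynomial.pderiv i f) := by
  induction f using MvPolynomial.induction_on with
  | C c =>
    simp only [MvPolynomial.algHom_C, Polynomial.algebraMap_apply, derivative_C,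
      MvPolynomial.pderiv_C, map_zero, mul_zero, Finset.sum_const_zero]
  | add p q hp hq => simp only [map_add, hp, hq, mul_add, Finset.sum_add_distrib]
  | mul_X p j hp =>
    set S : σ → A[X] := fun i => C (b i) + C (a i) * X with hSdef
    have hSj : derivative (S j) = C (a j) := by simp [S]
    have hpd : ∀ x, MvPolynomial.pderiv x (p * MvPolynomial.X j) =
        MvPolynomial.pderiv x p * MvPolynomial.X j + (if x = j then p else 0) := by
      intro x
      rw [Derivation.leibniz, MvPolynomial.pderiv_X, smul_eq_mul, smul_eq_mul]
      by_cases hx : x = j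
      · subst hx; simp only [Pi.single_eq_same, mul_one, if_true]; ring
      · simp [Ne.symm hx, hx, mul_comm]
    rw [map_mul, MvPolynomial.aeval_X, derivative_mul, hp, hSj]
    have hsum : ∑ x, C (a x) * MvPolynomial.aeval S (MvPolynomial.pderiv x (p * MvPolynomial.X j)) =
        ∑ x, C (a x) * (MvPolynomial.aeval S (MvPolynomial.pderiv x p) * S j) +
          C (a j) * MvPolynomial.aeval S p := by
      simp only [hpd, map_add, map_mul, MvPolynomial.aeval_X, mul_add, Finset.sum_add_distrib]
      refine congrArg₂ (· + ·) rfl ?_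
      rw [Finset.sum_eq_single j (fun x _ hx => by simp [hx])
        (fun h => (h (Finset.mem_univ j)).elim)]
      simp
    rw [hsum, Finset.sum_mul]
    exact congrArg₂ (· + ·) (Finset.sum_congr rfl fun i _ => by ring) (by ring)

end TopCoeff

/-! ### Irreducibility under adjoining variables -/

section IrreducibleRename

open _root_.MvPolynomial

variable {R : Type*} [CommRing R] [IsDomain R] {σ τ ρ : Type*}

/-- A constant `C a` with `a` irreducible is irreducible in `D[X_ρ]` (`D` a domain). [folklore] -/
theorem irreducible_C_of_irreducible {a : R} (ha : Irreducible a) :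
    Irreducible (C a : MvPolynomial ρ R) := by
  have hunit : ∀ b : R, IsUnit (C b : MvPolynomial ρ R) → IsUnit b := fun b hb => by
    simpa using hb.map (constantCoeff : MvPolynomial ρ R →+* R)
  refine ⟨fun h => ha.not_isUnit (hunit a h), fun G H hGH => ?_⟩
  have ha0 : (C a : MvPolynomial ρ R) ≠ 0 := by
    rw [Ne, C_eq_zero]; exact ha.ne_zero
  have hG0 : G ≠ 0 := fun h => ha0 (by rw [hGH, h, zero_mul])
  have hH0 : H ≠ 0 := fun h => ha0 (by rw [hGH, h, mul_zero])
  have hdeg := congrArg totalDegree hGH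
  rw [totalDegree_C, totalDegree_mul_of_isDomain hG0 hH0] at hdeg
  obtain ⟨g, rfl⟩ : ∃ g, G = C g := ⟨_, (totalDegree_eq_zero_iff_eq_C (p := G)).mp (by omega)⟩
  obtain ⟨h, rfl⟩ : ∃ h, H = C h := ⟨_, (totalDegree_eq_zero_iff_eq_C (p := H)).mp (by omega)⟩
  rw [← map_mul, (C_injective _ _).eq_iff] at hGH
  rcases ha.isUnit_or_isUnit hGH with hg | hh
  · exact Or.inl (hg.map C)
  · exact Or.inr (hh.map C)

/-- Adjoining further variables (on the left of a sum) preserves irreducibility. [folklore] -/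
theorem irreducible_rename_inr {f : MvPolynomial σ R} (hf : Irreducible f) :
    Irreducible (rename (Sum.inr : σ → ρ ⊕ σ) f) := by
  have h : sumAlgEquiv R ρ σ (rename Sum.inr f) = C f := by
    have := congrArg (fun φ : MvPolynomial σ R →ₐ[R] _ => φ f)
      (sumAlgEquiv_comp_rename_inr R ρ σ)
    simpa using this
  have hC : Irreducible (C f : MvPolynomial ρ (MvPolynomial σ R)) :=
    irreducible_C_of_irreducible hf
  rw [← h] at hC
  exact (MulEquiv.irreducible_iff (sumAlgEquiv R ρ σ)).mp hC

/-- Renaming along an injective map of variables preserves irreducibility. [folklore] -/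
theorem irreducible_rename_of_injective {e : σ → τ} (he : Function.Injective e)
    {f : MvPolynomial σ R} (hf : Irreducible f) : Irreducible (rename e f) := by
  classical
  let E : ↥(Set.range e)ᶜ ⊕ σ ≃ τ :=
    (Equiv.sumComm _ _).trans
      (((Equiv.ofInjective e he).sumCongr (Equiv.refl _)).trans (Equiv.Set.sumCompl (Set.range e)))
  have hE : ∀ s, E (Sum.inr s) = e s := fun s => by
    simp [E, Equiv.Set.sumCompl_apply_inl]
  have : rename e f = rename E (rename (Sum.inr : σ → ↥(Set.range e)ᶜ ⊕ σ) f) := by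
    rw [rename_rename]
    exact congrArg (fun g => rename g f) (funext fun s => (hE s).symm)
  rw [this]
  exact (MulEquiv.irreducible_iff (renameEquiv R E)).mpr (irreducible_rename_inr hf)

end IrreducibleRename


/-! ### Line restrictions `f(ν₀ + X, ν₁ + ω₁X, …, νₙ + ωₙX)` and the generic line -/

section LineRestrict

open Polynomial

variable {K : Type*} [Field K] {L : Type*} [CommRing L] [Algebra K L]
variable {L' : Type*} [CommRing L'] [Algebra K L'] {n : ℕ}

/-- The **line restriction** `f(ν₀ + X, ν₁ + ω₁X, …, νₙ + ωₙX) ∈ L[X]` of `f ∈ K[x₀, …, xₙ]` to the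
line through `ν` with direction `(1, ω)` — Kaltofen's `χ(x, 0, …, 0) = f(x + ν₁, ω₂x + ν₂, …)`
(the polynomial whose leading coefficient and discriminant make up condition (33)), i.e. the
plane section `planeSection f ν ω η` at `Y = 0`. [cite: Kaltofen1995, §4 (31)–(33)] -/
def lineRestrict (f : MvPolynomial (Fin (n + 1)) K) (ν : Fin (n + 1) → L) (ω : Fin n → L) :
    L[X] :=
  MvPolynomial.aeval (fun i => C (ν i) + C ((Fin.cons 1 ω : Fin (n + 1) → L) i) * X) f

/-- `deg_X f(ν + X(1, ω)) ≤ deg f`. [folklore] -/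
theorem natDegree_lineRestrict_le (f : MvPolynomial (Fin (n + 1)) K) (ν : Fin (n + 1) → L)
    (ω : Fin n → L) : (lineRestrict f ν ω).natDegree ≤ f.totalDegree :=
  natDegree_aeval_linear_le _ _ f

/-- The coefficient of `X^δ` (`δ = deg f`) of the line restriction is `f_δ(1, ω)` (Kaltofen's
(30)). [cite: Kaltofen1995, §4 (30)] -/
theorem coeff_lineRestrict_totalDegree (f : MvPolynomial (Fin (n + 1)) K) (ν : Fin (n + 1) → L)
    (ω : Fin n → L) :
    (lineRestrict f ν ω).coeff f.totalDegree =
      MvPolynomial.aeval (Fin.cons 1 ω : Fin (n + 1) → L)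
        (MvPolynomial.homogeneousComponent f.totalDegree f) :=
  coeff_aeval_linear_totalDegree _ _ f

/-- Line restrictions are functorial in the coefficient algebra. [folklore] -/
theorem map_lineRestrict (f : MvPolynomial (Fin (n + 1)) K) (ν : Fin (n + 1) → L) (ω : Fin n → L)
    (φ : L →ₐ[K] L') :
    (lineRestrict f ν ω).map (φ : L →+* L') = lineRestrict f (φ ∘ ν) (φ ∘ ω) := by
  have h : (Polynomial.mapRingHom (φ : L →+* L')).comp
      (MvPolynomial.aeval (R := K)
        (fun i => C (ν i) + C ((Fin.cons 1 ω : Fin (n + 1) → L) i) * X)).toRingHom =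
      (MvPolynomial.aeval (R := K)
        (fun i => C ((φ ∘ ν) i) + C ((Fin.cons 1 (φ ∘ ω) : Fin (n + 1) → L') i) * X)).toRingHom := by
    refine MvPolynomial.ringHom_ext (fun c => ?_) (fun i => ?_)
    · simp [Polynomial.algebraMap_apply, AlgHom.commutes]
    · refine Fin.cases ?_ (fun j => ?_) i <;> simp
  exact DFunLike.congr_fun h f

/-- Base change of `f` to an intermediate field does not change its line restrictions.
[folklore] -/
theorem lineRestrict_map {K' : Type*} [Field K'] [Algebra K K'] [Algebra K' L] [IsScalarTower K K' L]
    (f : MvPolynomial (Fin (n + 1)) K) (ν : Fin (n + 1) → L) (ω : Fin n → L) :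
    lineRestrict (MvPolynomial.map (algebraMap K K') f) ν ω = lineRestrict f ν ω :=
  MvPolynomial.aeval_map_algebraMap K' _ f

end LineRestrict

section GenericLine

open Polynomial

variable {k : Type*} [Field k] {n : ℕ}

/-- The **generic line restriction** `φ = f(v₀ + X, v₁ + w₁X, …, vₙ + wₙX) ∈ k[v, w][X]`
(`v = X ∘ Sum.inl`, `w = X ∘ Sum.inr`): Kaltofen's `ϕ(x, 0, …, 0)` over
`L = K(v₁, …, vₙ, w₂, …, wₙ)`. [cite: Kaltofen1995, §4 (before Lemma 2)] -/
def genLine (f : MvPolynomial (Fin (n + 1)) k) :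
    Polynomial (MvPolynomial (Fin (n + 1) ⊕ Fin n) k) :=
  lineRestrict f (fun j => MvPolynomial.X (Sum.inl j)) (fun i => MvPolynomial.X (Sum.inr i))

/-- Specialising the generic line restriction at `(ν, ω)` gives the line restriction.
[folklore] -/
theorem map_genLine {L : Type*} [CommRing L] [Algebra k L] (f : MvPolynomial (Fin (n + 1)) k)
    (ν : Fin (n + 1) → L) (ω : Fin n → L) :
    (genLine f).map ((MvPolynomial.aeval (Sum.elim ν ω) :
        MvPolynomial (Fin (n + 1) ⊕ Fin n) k →ₐ[k] L) : MvPolynomial (Fin (n + 1) ⊕ Fin n) k →+* L) =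
      lineRestrict f ν ω := by
  rw [genLine, map_lineRestrict]
  congr 1 <;> funext i <;> simp

/-- The leading coefficient of the generic line restriction is the dehomogenised top component
`f_δ(1, w)` (Kaltofen's (30): "`l := ldcf_x(ϕ) = ∑_{e₁+⋯+eₙ = d} q_e w₂^{e₂} ⋯ wₙ^{eₙ}` …
Since `f` has total degree `d`, `l` is a non-zero element in `K[w₂, …, wₙ]`").
[cite: Kaltofen1995, §4 (30)] -/
theorem coeff_genLine_totalDegree (f : MvPolynomial (Fin (n + 1)) k) :
    (genLine f).coeff f.totalDegree =
      MvPolynomial.rename Sum.inr (Literature.RingTheory.NoetherNormalization.dehomTop f) := by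
  rw [genLine, coeff_lineRestrict_totalDegree, Literature.RingTheory.NoetherNormalization.dehomTop,
    ← AlgHom.comp_apply]
  congr 1
  refine MvPolynomial.algHom_ext fun i => ?_
  refine Fin.cases ?_ (fun j => ?_) i <;> simp

/-- `deg_X` of the generic line restriction is exactly `deg f` (for `f ≠ 0`). [cite: Kaltofen1995, §4 (30)] -/
theorem natDegree_genLine {f : MvPolynomial (Fin (n + 1)) k} (hf : f ≠ 0) :
    (genLine f).natDegree = f.totalDegree := by
  refine le_antisymm (natDegree_lineRestrict_le f _ _) (le_natDegree_of_ne_zero ?_)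
  rw [coeff_genLine_totalDegree]
  exact (MvPolynomial.rename_injective _ Sum.inr_injective).ne
    (Literature.RingTheory.NoetherNormalization.dehomTop_ne_zero hf) |>.trans_eq (map_zero _) |> id

/-- The generic line restriction of an irreducible `f` is irreducible in `k[v, w][X]`
(Kaltofen's Lemma 2: `x ← X₁ − v₁`, `vᵢ ← Xᵢ − wᵢ(X₁ − v₁)` inverts the substitution, which is
therefore an automorphism of `k[X, v, w] ⊃ k[X₁, …, Xₙ]`). [cite: Kaltofen1995, §4 Lemma 2] -/
theorem irreducible_genLine {f : MvPolynomial (Fin (n + 1)) k} (hf : Irreducible f) :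
    Irreducible (genLine f) := by
  -- the ambient ring `B = k[X, v, w]`, `X = X none`, `v = X ∘ some ∘ inl`, `w = X ∘ some ∘ inr`
  set Ωf : Option (Fin (n + 1) ⊕ Fin n) → MvPolynomial (Option (Fin (n + 1) ⊕ Fin n)) k :=
    fun o => Option.elim o (MvPolynomial.X none) (Sum.elim
      (Fin.cases (MvPolynomial.X (some (Sum.inl 0)) + MvPolynomial.X none)
        (fun i => MvPolynomial.X (some (Sum.inl i.succ)) +
          MvPolynomial.X (some (Sum.inr i)) * MvPolynomial.X none))
      (fun i => MvPolynomial.X (some (Sum.inr i)))) with hΩf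
  set Ωg : Option (Fin (n + 1) ⊕ Fin n) → MvPolynomial (Option (Fin (n + 1) ⊕ Fin n)) k :=
    fun o => Option.elim o (MvPolynomial.X none) (Sum.elim
      (Fin.cases (MvPolynomial.X (some (Sum.inl 0)) - MvPolynomial.X none)
        (fun i => MvPolynomial.X (some (Sum.inl i.succ)) -
          MvPolynomial.X (some (Sum.inr i)) * MvPolynomial.X none))
      (fun i => MvPolynomial.X (some (Sum.inr i)))) with hΩg
  have h1 : (MvPolynomial.aeval Ωf).comp (MvPolynomial.aeval Ωg) = AlgHom.id k _ := by
    refine MvPolynomial.algHom_ext fun o => ?_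
    rcases o with _ | j | i
    · simp [Ωf, Ωg]
    · refine Fin.cases ?_ (fun i => ?_) j
      · simp [Ωf, Ωg]
      · simp only [Ωf, Ωg, AlgHom.comp_apply, MvPolynomial.aeval_X, Option.elim_some,
          Sum.elim_inl, Fin.cases_succ, map_sub, map_mul, Option.elim_none, Sum.elim_inr,
          AlgHom.id_apply]
        ring
    · simp [Ωf, Ωg]
  have h2 : (MvPolynomial.aeval Ωg).comp (MvPolynomial.aeval Ωf) = AlgHom.id k _ := by
    refine MvPolynomial.algHom_ext fun o => ?_
    rcases o with _ | j | i
    · simp [Ωf, Ωg]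
    · refine Fin.cases ?_ (fun i => ?_) j
      · simp [Ωf, Ωg]
      · simp only [Ωf, Ωg, AlgHom.comp_apply, MvPolynomial.aeval_X, Option.elim_some,
          Sum.elim_inl, Fin.cases_succ, map_add, map_mul, Option.elim_none, Sum.elim_inr,
          AlgHom.id_apply]
        ring
    · simp [Ωf, Ωg]
  set Ω := AlgEquiv.ofAlgHom (MvPolynomial.aeval Ωf) (MvPolynomial.aeval Ωg) h1 h2 with hΩ
  set e := MvPolynomial.optionEquivLeft k (Fin (n + 1) ⊕ Fin n) with he
  have hgen : genLine f = e (Ω (MvPolynomial.rename (some ∘ Sum.inl) f)) := by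
    change genLine f = (e.toAlgHom.comp (Ω.toAlgHom.comp
      (MvPolynomial.rename (some ∘ Sum.inl : Fin (n + 1) → Option (Fin (n + 1) ⊕ Fin n))))) f
    rw [genLine, lineRestrict]
    congr 1
    refine MvPolynomial.algHom_ext fun j => ?_
    refine Fin.cases ?_ (fun i => ?_) j
    · simp [e, Ω, Ωf, MvPolynomial.optionEquivLeft_X_some, MvPolynomial.optionEquivLeft_X_none]
    · simp [e, Ω, Ωf, MvPolynomial.optionEquivLeft_X_some, MvPolynomial.optionEquivLeft_X_none]
  rw [hgen, MulEquiv.irreducible_iff e, MulEquiv.irreducible_iff Ω]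
  exact irreducible_rename_of_injective (Option.some_injective _ |>.comp Sum.inl_injective) hf


end GenericLine

/-! ### Coefficientwise degree bounds -/

section CoeffBounds

open Polynomial

variable {R : Type*} [CommRing R] {D : R → ℕ}

/-- Coefficientwise sub-degree bounds multiply. [folklore] -/
theorem IsSubdegree.coeff_mul_le (hD : IsSubdegree D) {p q : R[X]} {B₁ B₂ : ℕ}
    (hp : ∀ i, D (p.coeff i) ≤ B₁) (hq : ∀ i, D (q.coeff i) ≤ B₂) :
    ∀ i, D ((p * q).coeff i) ≤ B₁ + B₂ := fun i => by
  rw [Polynomial.coeff_mul]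
  exact hD.sum_le _ _ _ fun x _ => (hD.mul _ _).trans (Nat.add_le_add (hp _) (hq _))

/-- Coefficientwise sub-degree bounds for powers. [folklore] -/
theorem IsSubdegree.coeff_pow_le (hD : IsSubdegree D) {p : R[X]} {B : ℕ}
    (hp : ∀ i, D (p.coeff i) ≤ B) (m : ℕ) : ∀ i, D ((p ^ m).coeff i) ≤ m * B := by
  induction m with
  | zero =>
    intro i
    rw [pow_zero, Polynomial.coeff_one]
    split_ifs
    · rw [hD.one]; exact Nat.zero_le _
    · rw [hD.zero]; exact Nat.zero_le _
  | succ m ih =>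
    intro i
    rw [pow_succ, Nat.succ_mul]
    exact hD.coeff_mul_le ih hp i

/-- Coefficientwise sub-degree bounds for finite products. [folklore] -/
theorem IsSubdegree.coeff_prod_le (hD : IsSubdegree D) {ι : Type*} (s : Finset ι)
    (g : ι → R[X]) (B : ι → ℕ) (h : ∀ a ∈ s, ∀ i, D ((g a).coeff i) ≤ B a) :
    ∀ i, D ((∏ a ∈ s, g a).coeff i) ≤ ∑ a ∈ s, B a := by
  classical
  induction s using Finset.induction_on with
  | empty =>
    intro i
    rw [Finset.prod_empty, Finset.sum_empty, Polynomial.coeff_one]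
    split_ifs
    · rw [hD.one]
    · rw [hD.zero]
  | insert a s ha ih =>
    intro i
    rw [Finset.prod_insert ha, Finset.sum_insert ha]
    exact hD.coeff_mul_le (h a (by simp)) (ih fun b hb => h b (by simp [hb])) i

/-- Coefficientwise sub-degree bounds for finite sums. [folklore] -/
theorem IsSubdegree.coeff_sum_le (hD : IsSubdegree D) {ι : Type*} (s : Finset ι)
    (g : ι → R[X]) (B : ℕ) (h : ∀ a ∈ s, ∀ i, D ((g a).coeff i) ≤ B) :
    ∀ i, D ((∑ a ∈ s, g a).coeff i) ≤ B := fun i => by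
  rw [Polynomial.finsetSum_coeff]
  exact hD.sum_le _ _ _ fun a ha => h a ha i

/-- **Coefficients of a linear substitution**: if the slopes `aᵢ` and intercepts `bᵢ` have
sub-degree `≤ 1` and scalars have sub-degree `0`, every `X`-coefficient of `f(b + aX)` has
sub-degree `≤ deg f` (e.g.: the coefficients of the generic line restriction have total degree
`≤ deg f` in `(v, w)`). [folklore] -/
theorem IsSubdegree.coeff_aeval_linear_le {K : Type*} [CommRing K] [Algebra K R] {σ : Type*}
    [Fintype σ] (hD : IsSubdegree D) (halg : ∀ c : K, D (algebraMap K R c) = 0)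
    (a b : σ → R) (ha : ∀ i, D (a i) ≤ 1) (hb : ∀ i, D (b i) ≤ 1) (f : MvPolynomial σ K) :
    ∀ i, D ((MvPolynomial.aeval (fun i => C (b i) + C (a i) * X) f).coeff i) ≤ f.totalDegree := by
  rw [MvPolynomial.aeval_def, MvPolynomial.eval₂_eq']
  refine hD.coeff_sum_le _ _ _ fun d hd => ?_
  have hlin : ∀ j i, D ((C (b j) + C (a j) * X : R[X]).coeff i) ≤ 1 := by
    intro j i
    rw [Polynomial.coeff_add, Polynomial.coeff_C, Polynomial.coeff_C_mul_X]
    rcases i with _ | _ | i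
    · simpa [hD.zero] using hb j
    · simpa [hD.zero] using ha j
    · simp [hD.zero]
  have h := hD.coeff_mul_le (p := (algebraMap K R[X]) (MvPolynomial.coeff d f)) (B₁ := 0)
    (fun i => by
      rw [Polynomial.algebraMap_apply, Polynomial.coeff_C]
      split_ifs
      · exact (halg _).le
      · rw [hD.zero])
    (hD.coeff_prod_le Finset.univ (fun j => (C (b j) + C (a j) * X) ^ d j) (fun j => d j * 1)
      fun j _ => hD.coeff_pow_le (hlin j) (d j))
  intro i
  refine (h i).trans ?_
  rw [zero_add]
  calc ∑ j, d j * 1 = d.sum fun _ e => e := by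
        simp only [mul_one]; exact (Finsupp.sum_fintype d (fun _ e => e) (fun _ => rfl)).symm
    _ ≤ f.totalDegree := MvPolynomial.le_totalDegree hd

/-- Coefficients of the derivative obey the same sub-degree bounds (natural-number scalars have
sub-degree `0`). [folklore] -/
theorem IsSubdegree.coeff_derivative_le (hD : IsSubdegree D) (hnat : ∀ m : ℕ, D (m : R) = 0)
    {p : R[X]} {B : ℕ} (hp : ∀ i, D (p.coeff i) ≤ B) : ∀ i, D ((derivative p).coeff i) ≤ B := by
  intro i
  rw [Polynomial.coeff_derivative]
  refine (hD.mul _ _).trans ?_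
  rw [show ((i : R) + 1) = ((i + 1 : ℕ) : R) by push_cast; ring, hnat, add_zero]
  exact hp _

end CoeffBounds

/-! ### Kaltofen's Lemma 3: the generic line restriction is squarefree -/

section Lemma3

open Polynomial
open Literature.NumberTheory.DiophantineGeometry (exists_pderiv_ne_zero)

variable {k : Type*} [Field k] {n : ℕ}

/-- If the generic line restriction has zero `X`-derivative then all partial derivatives of `f`
vanish: apply the retraction `X ↦ 0`, `vⱼ ↦ xⱼ`, `wᵢ ↦ ωᵢ` of the generic substitution to the
chain rule `∂φ/∂X = ∂₀f(…) + ∑ wᵢ ∂ᵢf(…)` (Kaltofen's Lemma 3, Case 1: "the coefficient of `x^{eᵢ}`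
in `ψ(x, 0, …, 0)` is … `≠ 0`, resulting in a non-zero partial derivative").
[cite: Kaltofen1995, §4 Lemma 3] -/
theorem pderiv_eq_zero_of_derivative_genLine_eq_zero {f : MvPolynomial (Fin (n + 1)) k}
    (h : derivative (genLine f) = 0) (j : Fin (n + 1)) : MvPolynomial.pderiv j f = 0 := by
  classical
  set a : Fin (n + 1) → MvPolynomial (Fin (n + 1) ⊕ Fin n) k :=
    Fin.cons 1 fun i => MvPolynomial.X (Sum.inr i) with ha
  set b : Fin (n + 1) → MvPolynomial (Fin (n + 1) ⊕ Fin n) k :=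
    fun j => MvPolynomial.X (Sum.inl j) with hb
  have hder : derivative (genLine f) = ∑ i, C (a i) *
      MvPolynomial.aeval (fun i => C (b i) + C (a i) * X) (MvPolynomial.pderiv i f) :=
    derivative_aeval_linear a b f
  rw [h] at hder
  -- the retraction `Λ_ω`: `X ↦ 0`, `v_j ↦ x_j`, `w_i ↦ ω_i`
  have key : ∀ ω : Fin n → k, MvPolynomial.pderiv 0 f +
      ∑ i : Fin n, MvPolynomial.C (ω i) * MvPolynomial.pderiv i.succ f = 0 := by
    intro ω
    set θ : MvPolynomial (Fin (n + 1) ⊕ Fin n) k →ₐ[k] MvPolynomial (Fin (n + 1)) k :=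
      MvPolynomial.aeval (Sum.elim MvPolynomial.X fun i => MvPolynomial.C (ω i)) with hθ
    have hθl : ∀ j, θ (MvPolynomial.X (Sum.inl j)) = MvPolynomial.X j := fun j => by
      rw [hθ, MvPolynomial.aeval_X, Sum.elim_inl]
    have hθr : ∀ i, θ (MvPolynomial.X (Sum.inr i)) = MvPolynomial.C (ω i) := fun i => by
      rw [hθ, MvPolynomial.aeval_X, Sum.elim_inr]
    set Λ : (MvPolynomial (Fin (n + 1) ⊕ Fin n) k)[X] →ₐ[k] MvPolynomial (Fin (n + 1)) k :=
      Polynomial.aevalTower θ 0 with hΛ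
    have hΛ' : ∀ g : MvPolynomial (Fin (n + 1)) k,
        Λ (MvPolynomial.aeval (fun i => C (b i) + C (a i) * X) g) = g := by
      intro g
      rw [← AlgHom.comp_apply]
      conv_rhs => rw [← AlgHom.id_apply (R := k) g]
      congr 1
      refine MvPolynomial.algHom_ext fun j => ?_
      rw [AlgHom.comp_apply, MvPolynomial.aeval_X, AlgHom.id_apply, map_add, map_mul,
        Polynomial.aevalTower_C, Polynomial.aevalTower_C, Polynomial.aevalTower_X, mul_zero,
        add_zero, hb]
      exact hθl j
    have hΛa0 : Λ (C (a 0)) = 1 := by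
      rw [hΛ, Polynomial.aevalTower_C, ha, Fin.cons_zero, map_one]
    have hΛas : ∀ i : Fin n, Λ (C (a i.succ)) = MvPolynomial.C (ω i) := fun i => by
      rw [hΛ, Polynomial.aevalTower_C, ha, Fin.cons_succ]
      exact hθr i
    have := congrArg Λ hder
    rw [map_zero, map_sum] at this
    simp only [map_mul, hΛ', Fin.sum_univ_succ, hΛa0, one_mul, hΛas] at this
    exact this.symm
  refine Fin.cases ?_ (fun i => ?_) j
  · simpa using key 0
  · have h0 : MvPolynomial.pderiv 0 f = 0 := by simpa using key 0
    have := key (Pi.single i 1)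
    rw [h0, zero_add, Finset.sum_eq_single i (fun i' _ hi' => by simp [hi'])
      (by simp)] at this
    simpa using this

/-- **The generic line restriction of an absolutely irreducible `f` has non-zero derivative**
(over an algebraically closed field an irreducible polynomial has a non-zero partial derivative,
`exists_pderiv_ne_zero`; Kaltofen's Lemma 3, Case 1). [cite: Kaltofen1995, §4 Lemma 3] -/
theorem derivative_genLine_ne_zero [IsAlgClosed k] {f : MvPolynomial (Fin (n + 1)) k}
    (hf : Irreducible f) : derivative (genLine f) ≠ 0 := fun h => by
  obtain ⟨i, hi⟩ := exists_pderiv_ne_zero hf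
  exact hi (pderiv_eq_zero_of_derivative_genLine_eq_zero h i)

/-- **Kaltofen's `Υ`**: the resultant (with formal degrees `δ`, `δ − 1`, `δ = deg f`) of the
generic line restriction and its `X`-derivative — the product of the generic leading coefficient
(30) and the generic discriminant (31) up to the normalisation `l^{2d−1}` ("One chooses `Υ` to be
the product of these generic polynomials", proof of Lemma 4). [cite: Kaltofen1995, §4 Lemma 4] -/
def upsilon (f : MvPolynomial (Fin (n + 1)) k) : MvPolynomial (Fin (n + 1) ⊕ Fin n) k :=
  Polynomial.resultant (genLine f) (derivative (genLine f)) f.totalDegree (f.totalDegree - 1)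

/-- The generic line restriction of an irreducible `f` of positive degree is primitive over
`k[v, w]`. [folklore] -/
theorem isPrimitive_genLine {f : MvPolynomial (Fin (n + 1)) k} (hf : Irreducible f)
    (hδ : 0 < f.totalDegree) : (genLine f).IsPrimitive := by
  intro r hr
  obtain ⟨q, hq⟩ := hr
  rcases (irreducible_genLine hf).isUnit_or_isUnit hq with hu | hu
  · exact Polynomial.isUnit_C.1 hu
  · exfalso
    obtain ⟨u, -, rfl⟩ := Polynomial.isUnit_iff.1 hu
    rw [← map_mul] at hq
    have := congrArg Polynomial.natDegree hq
    rw [natDegree_genLine hf.ne_zero, Polynomial.natDegree_C] at this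
    omega

/-- **Kaltofen's Lemma 3: `Υ ≠ 0` for `f` absolutely irreducible** ("if `r = 0`, `f` factors
over `K̄`"). Over `L = Frac k[v, w]` the vanishing of `Υ` makes `φ` and `∂φ/∂x` non-coprime
(`Polynomial.resultant_eq_zero_iff`); `φ` is irreducible over `L` (Lemma 2 + Gauss's lemma), so
`φ ∣ ∂φ/∂x`, forcing `∂φ/∂x = 0`, which Case 1 excludes. [cite: Kaltofen1995, §4 Lemmas 3–4] -/
theorem upsilon_ne_zero [IsAlgClosed k] {f : MvPolynomial (Fin (n + 1)) k} (hf : Irreducible f)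
    (hδ : 0 < f.totalDegree) : upsilon f ≠ 0 := by
  intro h0
  set P := MvPolynomial (Fin (n + 1) ⊕ Fin n) k
  set F := FractionRing P
  have hinj : Function.Injective (algebraMap P F) := IsFractionRing.injective _ _
  set φ := genLine f with hφ
  have hφdeg : φ.natDegree = f.totalDegree := natDegree_genLine hf.ne_zero
  set φF := φ.map (algebraMap P F) with hφF
  have hφFdeg : φF.natDegree = f.totalDegree := by
    rw [hφF, natDegree_map_eq_of_injective hinj, hφdeg]
  have hmap := Polynomial.resultant_map_map φ (derivative φ) f.totalDegree (f.totalDegree - 1)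
    (algebraMap P F)
  rw [show Polynomial.resultant φ (derivative φ) f.totalDegree (f.totalDegree - 1) = upsilon f
    from rfl, h0, map_zero, ← Polynomial.derivative_map] at hmap
  -- remove the degree padding of the derivative
  obtain ⟨j, hj⟩ : ∃ j, f.totalDegree - 1 = (derivative φF).natDegree + j :=
    ⟨f.totalDegree - 1 - (derivative φF).natDegree, by
      have := natDegree_derivative_le φF; rw [hφFdeg] at this; omega⟩
  rw [← hφF, hj, Polynomial.resultant_add_right_deg _ _ _ _ j le_rfl] at hmap
  have hφF0 : φF ≠ 0 := fun h => by rw [h, natDegree_zero] at hφFdeg; omega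
  have hlc : φF.coeff f.totalDegree ≠ 0 := by
    rw [← hφFdeg, Polynomial.coeff_natDegree]; exact leadingCoeff_ne_zero.2 hφF0
  have hres : Polynomial.resultant φF (derivative φF) f.totalDegree (derivative φF).natDegree = 0 :=
    (mul_eq_zero.1 hmap).resolve_left (pow_ne_zero _ hlc)
  rw [← hφFdeg] at hres
  have hncop : ¬ IsCoprime φF (derivative φF) := (Polynomial.resultant_eq_zero_iff.1 hres).2
  -- Gauss: `φ` stays irreducible over the fraction field
  have hirrF : Irreducible φF :=
    ((isPrimitive_genLine hf hδ).irreducible_iff_irreducible_map_fraction_map (K := F)).1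
      (irreducible_genLine hf)
  have hdvd : φF ∣ derivative φF := by
    by_contra hnd
    exact hncop (hirrF.coprime_iff_not_dvd.2 hnd)
  have hder0 : derivative φF = 0 := by
    by_contra hne
    have h1 := natDegree_le_of_dvd hdvd hne
    have h2 := natDegree_derivative_lt (p := φF) (by rw [hφFdeg]; omega)
    omega
  have : derivative φ = 0 := by
    apply Polynomial.map_injective (algebraMap P F) hinj
    rw [Polynomial.map_zero, ← Polynomial.derivative_map]
    exact hder0
  exact derivative_genLine_ne_zero hf this

/-- **`deg Υ ≤ 2δ²`** (Kaltofen's Lemma 4: the Sylvester determinant has `2δ − 1` rows with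
entries of total degree `≤ δ` in `(v, w)`). [cite: Kaltofen1995, §4 Lemma 4] -/
theorem totalDegree_upsilon_le (f : MvPolynomial (Fin (n + 1)) k) :
    (upsilon f).totalDegree ≤ 2 * f.totalDegree ^ 2 := by
  set δ := f.totalDegree with hδ
  have hD := isSubdegree_totalDegree (σ := Fin (n + 1) ⊕ Fin n) (S := k)
  have hcoeff : ∀ i, ((genLine f).coeff i).totalDegree ≤ δ := by
    refine hD.coeff_aeval_linear_le (fun c => ?_) _ _ (fun i => ?_) (fun i => ?_) f
    · rw [MvPolynomial.algebraMap_eq, MvPolynomial.totalDegree_C]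
    · refine Fin.cases ?_ (fun j => ?_) i
      · simp
      · simp [MvPolynomial.totalDegree_X]
    · exact (MvPolynomial.totalDegree_X (R := k) (Sum.inl i)).le
  have hcoeff' : ∀ i, ((derivative (genLine f)).coeff i).totalDegree ≤ δ :=
    hD.coeff_derivative_le (fun m => by
      rw [← map_natCast (MvPolynomial.C : k →+* MvPolynomial (Fin (n + 1) ⊕ Fin n) k) m,
        MvPolynomial.totalDegree_C]) hcoeff
  rw [upsilon, Polynomial.resultant]
  refine (hD.det_le _ (fun _ => δ) fun i j => ?_).trans ?_
  · simp only [Polynomial.sylvester, Matrix.of_apply]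
    induction j using Fin.addCases with
    | left j => simp only [Fin.addCases_left]; split_ifs <;> simp [hcoeff']
    | right j => simp only [Fin.addCases_right]; split_ifs <;> simp [hcoeff]
  · rw [Finset.sum_const, Finset.card_univ, Fintype.card_fin, smul_eq_mul]
    have : δ + (δ - 1) ≤ 2 * δ := by omega
    nlinarith

end Lemma3

/-! ### Kaltofen's Lemma 4: the genericity condition `Υ(ν, ω) ≠ 0` -/

section Lemma4

open Polynomial
open Literature.NumberTheory.DiophantineGeometry (IsAbsIrreducible totalDegree_map_of_injective)

universe u

variable {k : Type*} [Field k] {n : ℕ}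

/-- Specialising `Υ` at `(ν, ω)` gives the resultant of the line restriction and its derivative.
[cite: Kaltofen1995, §4 Lemma 4] -/
theorem aeval_upsilon {L : Type*} [CommRing L] [Algebra k L] (f : MvPolynomial (Fin (n + 1)) k)
    (ν : Fin (n + 1) → L) (ω : Fin n → L) :
    MvPolynomial.aeval (Sum.elim ν ω) (upsilon f) =
      Polynomial.resultant (lineRestrict f ν ω) (derivative (lineRestrict f ν ω))
        f.totalDegree (f.totalDegree - 1) := by
  rw [upsilon, ← map_genLine f ν ω, Polynomial.derivative_map, Polynomial.resultant_map_map]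
  rfl

/-- **Condition (33) from `Υ(ν, ω) ≠ 0`**: the line restriction `f(ν + X(1, ω))` has degree
exactly `δ = deg f` (i.e. `ldcf = f_δ(1, ω) ≠ 0`, "`ldcf_x(χ) ∈ K̄`") and is separable
("`Res_x(χ(x, 0, z), ∂χ(x, 0, z)/∂x) ≠ 0`"). If the degree dropped, the formal leading
coefficients of both the restriction and its derivative would vanish and with them the formal
resultant; with the degree exact, the formal resultant is the true one up to a power of the
leading coefficient, and `Polynomial.resultant_eq_zero_iff` gives coprimality.
[cite: Kaltofen1995, §4 Lemma 4, (33)] -/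
theorem natDegree_eq_and_separable_of_aeval_upsilon_ne_zero {L : Type*} [Field L] [Algebra k L]
    (f : MvPolynomial (Fin (n + 1)) k) (hδ : 0 < f.totalDegree) (ν : Fin (n + 1) → L)
    (ω : Fin n → L) (h : MvPolynomial.aeval (Sum.elim ν ω) (upsilon f) ≠ 0) :
    (lineRestrict f ν ω).natDegree = f.totalDegree ∧ (lineRestrict f ν ω).Separable := by
  rw [aeval_upsilon] at h
  set g := lineRestrict f ν ω with hg
  set δ := f.totalDegree with hδ'
  have hle : g.natDegree ≤ δ := natDegree_lineRestrict_le f ν ω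
  have hdeg : g.natDegree = δ := by
    by_contra hne
    have hlt : g.natDegree < δ := lt_of_le_of_ne hle hne
    apply h
    have hcoeff : g.coeff δ = 0 := Polynomial.coeff_eq_zero_of_natDegree_lt hlt
    have hd : (derivative g).coeff (δ - 1) = 0 := by
      rw [Polynomial.coeff_derivative, show δ - 1 + 1 = δ by omega, hcoeff, zero_mul]
    obtain ⟨j, hj⟩ : ∃ j, δ = g.natDegree + (j + 1) := ⟨δ - g.natDegree - 1, by omega⟩
    have : Polynomial.resultant g (derivative g) δ (δ - 1) =
        Polynomial.resultant g (derivative g) (g.natDegree + (j + 1)) (δ - 1) := by rw [← hj]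
    rw [this, Polynomial.resultant_add_left_deg _ _ _ _ _ le_rfl, hd, zero_pow (Nat.succ_ne_zero j),
      mul_zero, zero_mul]
  refine ⟨hdeg, ?_⟩
  obtain ⟨j, hj⟩ : ∃ j, δ - 1 = (derivative g).natDegree + j :=
    ⟨δ - 1 - (derivative g).natDegree, by
      have := natDegree_derivative_le g; rw [hdeg] at this; omega⟩
  rw [hj, Polynomial.resultant_add_right_deg _ _ _ _ j le_rfl] at h
  have hres : Polynomial.resultant g (derivative g) δ (derivative g).natDegree ≠ 0 :=
    fun h0 => h (by rw [h0, mul_zero])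
  rw [← hdeg] at hres
  have hg0 : g ≠ 0 := fun h0 => by rw [h0, natDegree_zero] at hdeg; omega
  have hiff := Polynomial.resultant_eq_zero_iff (f := g) (g := derivative g)
  by_contra hnc
  exact hres (hiff.2 ⟨Or.inl hg0, hnc⟩)

/-- `Υ` is compatible with base change of the field. [folklore] -/
theorem map_upsilon {K : Type*} [Field K] {K' : Type*} [Field K'] [Algebra K K']
    (f : MvPolynomial (Fin (n + 1)) K) :
    MvPolynomial.map (algebraMap K K') (upsilon f) =
      upsilon (MvPolynomial.map (algebraMap K K') f) := by
  set ι := algebraMap K K' with hι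
  have hdegf : (MvPolynomial.map ι f).totalDegree = f.totalDegree :=
    totalDegree_map_of_injective f ι.injective
  -- the generic line restriction commutes with base change
  have hgen : genLine (MvPolynomial.map ι f) = (genLine f).map
      (MvPolynomial.map ι : MvPolynomial (Fin (n + 1) ⊕ Fin n) K →+*
        MvPolynomial (Fin (n + 1) ⊕ Fin n) K') := by
    have hφ : (MvPolynomial.map ι : MvPolynomial (Fin (n + 1) ⊕ Fin n) K →+*
        MvPolynomial (Fin (n + 1) ⊕ Fin n) K') =
        ((MvPolynomial.mapAlgHom (Algebra.ofId K K') :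
          MvPolynomial (Fin (n + 1) ⊕ Fin n) K →ₐ[K] MvPolynomial (Fin (n + 1) ⊕ Fin n) K') :
          MvPolynomial (Fin (n + 1) ⊕ Fin n) K →+* MvPolynomial (Fin (n + 1) ⊕ Fin n) K') := by
      rw [MvPolynomial.mapAlgHom_coe_ringHom]
      rfl
    rw [genLine, genLine, hφ, map_lineRestrict, lineRestrict_map]
    congr 1 <;> funext i <;>
      simp only [Function.comp_apply, MvPolynomial.mapAlgHom_apply, MvPolynomial.map_X]
  rw [upsilon, upsilon, hdegf, hgen, Polynomial.derivative_map, Polynomial.resultant_map_map]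

/-- **Kaltofen 1995, Lemma 4** ("There exists a non-zero polynomial `Υ ∈ K[v₁, …, vₙ, w₂, …, wₙ]`,
`deg(Υ) ≤ 2d²`, such that `Υ(ν₁, …, ωₙ) ≠ 0 ⟹ ldcf_x(χ) ∈ K̄` and
`Res_x(χ(x, 0, z₂, …, zₙ), ∂χ(x, 0, z₂, …, zₙ)/∂x) ≠ 0`"), for `f ∈ K[x₀, …, xₙ]` absolutely
irreducible of total degree `δ ≥ 1`; the two conclusions of (33) are rendered as: the line
restriction `χ(x, 0, ·) = f(X + ν₀, ω₁X + ν₁, …)` has degree exactly `δ` and is separable.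
[cite: Kaltofen1995, §4 Lemma 4] -/
theorem kaltofen1995_lemma4 (K : Type u) [Field K] (n δ : ℕ) (f : MvPolynomial (Fin (n + 1)) K)
    (hδ : 0 < δ) (hdeg : f.totalDegree = δ) (hf : IsAbsIrreducible f) :
    ∃ Υ : MvPolynomial (Fin (n + 1) ⊕ Fin n) K, Υ ≠ 0 ∧ Υ.totalDegree ≤ 2 * δ ^ 2 ∧
      ∀ (ν : Fin (n + 1) → AlgebraicClosure K) (ω : Fin n → AlgebraicClosure K),
        MvPolynomial.aeval (Sum.elim ν ω) Υ ≠ 0 →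
          (lineRestrict f ν ω).natDegree = δ ∧ (lineRestrict f ν ω).Separable := by
  set Kb := AlgebraicClosure K
  set fb := MvPolynomial.map (algebraMap K Kb) f with hfb'
  have hfb : Irreducible fb := hf
  have hdegb : fb.totalDegree = δ := by
    rw [hfb', totalDegree_map_of_injective f (algebraMap K Kb).injective, hdeg]
  refine ⟨upsilon f, ?_, ?_, fun ν ω hΥ => ?_⟩
  · intro h0
    apply upsilon_ne_zero hfb (by omega : 0 < fb.totalDegree)
    rw [← map_upsilon, h0, map_zero]
  · rw [← totalDegree_map_of_injective (upsilon f) (algebraMap K Kb).injective, map_upsilon, ← hdegb]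
    exact totalDegree_upsilon_le fb
  · subst hdeg
    exact natDegree_eq_and_separable_of_aeval_upsilon_ne_zero f hδ ν ω hΥ

end Lemma4

/-! ### Kaltofen's Theorem 5 with the printed degree bound `deg Ψ ≤ 3δ⁴/2 − 2δ³ + δ²/2` -/

section SharpCertificate

open Polynomial
open Literature.NumberTheory.DiophantineGeometry

variable {R : Type*} [CommRing R] {D : R → ℕ}

/-- Column-wise degree bound for determinants. [folklore] -/
theorem IsSubdegree.det_le_col {ι : Type*} [Fintype ι] [DecidableEq ι] (hD : IsSubdegree D)
    (A : Matrix ι ι R) (c : ι → ℕ) (hA : ∀ i j, D (A i j) ≤ c j) : D A.det ≤ ∑ j, c j := by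
  rw [← Matrix.det_transpose]
  exact hD.det_le Aᵀ c fun i j => hA j i

/-- **Two-weight degree bound for resultants**: `Res^{m,n}(f, g)` is homogeneous of degree `n` in
the coefficients of `f` and of degree `m` in those of `g`, so if these have sub-degree `≤ e₁`,
`≤ e₂` respectively then `D (Res (f, g)) ≤ m e₂ + n e₁`. (With `f = ψ` monic of `x`-degree `d`,
`deg_y ≤ d`, and `g` of `x`-degree `≤ d − 1`, `deg_y ≤ d − 1`, this is Kaltofen's order
`ℓ = 2d(d − 1)` of §2.) [folklore] -/
theorem IsSubdegree.resultant_le_two_weights (hD : IsSubdegree D) (f g : R[X]) (m n e₁ e₂ : ℕ)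
    (hf : ∀ i, D (f.coeff i) ≤ e₁) (hg : ∀ i, D (g.coeff i) ≤ e₂) :
    D (Polynomial.resultant f g m n) ≤ m * e₂ + n * e₁ := by
  rw [Polynomial.resultant]
  refine (hD.det_le_col _ (fun j => Fin.addCases (fun _ => e₂) (fun _ => e₁) j) fun i j => ?_).trans
    (le_of_eq ?_)
  · simp only [Polynomial.sylvester, Matrix.of_apply]
    induction j using Fin.addCases with
    | left j => simp only [Fin.addCases_left]; split_ifs <;> simp [hg, hD.zero]
    | right j => simp only [Fin.addCases_right]; split_ifs <;> simp [hf, hD.zero]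
  · rw [Fin.sum_univ_add]
    simp

/-- **No small polynomial vanishes on a truncated root of an irreducible `χ` — two-weight form**
of `eq_zero_of_pow_dvd_eval` (`BertiniResultantProofs`): with `X`-coefficients of `χ` of
`Y`-degree `≤ d₁` and of `h` of `Y`-degree `≤ d₂`, precision `κ > δ d₂ + (δ − 1) d₁` suffices.
[cite: Kaltofen1995, §2 (order `ℓ = deg_y(f)(m + d − 1)`), §4 proof of Thm. 5] -/
theorem eq_zero_of_pow_dvd_eval₂ {A : Type*} [CommRing A] [IsDomain A] [UniqueFactorizationMonoid A]
    {χ h : Polynomial A[X]} {δ d₁ d₂ κ : ℕ} (hδ : 1 ≤ δ) (hχdeg : χ.natDegree = δ)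
    (hχu : IsUnit χ.leadingCoeff) (hχirr : Irreducible χ)
    (hχc : ∀ i, (χ.coeff i).natDegree ≤ d₁) (hhdeg : h.natDegree ≤ δ - 1)
    (hhc : ∀ i, (h.coeff i).natDegree ≤ d₂) (hκ : δ * d₂ + (δ - 1) * d₁ < κ)
    {a : A[X]} (hχa : (X : A[X]) ^ κ ∣ χ.eval a) (hha : (X : A[X]) ^ κ ∣ h.eval a) : h = 0 := by
  by_contra hh0
  obtain ⟨p, q, -, -, hpq⟩ := exists_mul_add_mul_eq_C_resultant χ h (m := δ) (n := δ - 1)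
    hχdeg.le hhdeg (Or.inl (by omega))
  set Res := resultant χ h δ (δ - 1) with hRes
  have hdvd : (X : A[X]) ^ κ ∣ Res := by
    have h1 := congrArg (Polynomial.eval a) hpq
    rw [eval_add, eval_mul, eval_mul, eval_C] at h1
    rw [← h1]
    exact dvd_add (hχa.mul_right _) (hha.mul_right _)
  have hRes0 : Res = 0 := by
    refine Polynomial.eq_zero_of_dvd_of_natDegree_lt hdvd ?_
    rw [natDegree_X_pow]
    exact (isSubdegree_natDegree.resultant_le_two_weights χ h δ (δ - 1) d₁ d₂ hχc hhc).trans_lt hκ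
  set K := FractionRing A[X] with hK
  have hinj : Function.Injective (algebraMap A[X] K) := IsFractionRing.injective _ _
  have hmap := resultant_map_map χ h δ (δ - 1) (algebraMap A[X] K)
  rw [← hRes, hRes0, map_zero] at hmap
  set χK := χ.map (algebraMap A[X] K) with hχK
  set hK' := h.map (algebraMap A[X] K) with hhK'
  have hK0 : hK' ≠ 0 := (Polynomial.map_ne_zero_iff hinj).2 hh0
  have hχKdeg : χK.natDegree = δ := by rw [hχK, natDegree_map_eq_of_injective hinj, hχdeg]
  have hhKdeg : hK'.natDegree ≤ δ - 1 := by
    rw [hhK', natDegree_map_eq_of_injective hinj]; exact hhdeg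
  obtain ⟨k, hk⟩ : ∃ k, δ - 1 = hK'.natDegree + k := ⟨δ - 1 - hK'.natDegree, by omega⟩
  rw [hk, resultant_add_right_deg _ _ _ _ k le_rfl] at hmap
  have hχK0 : χK ≠ 0 := fun h0 => by rw [h0, natDegree_zero] at hχKdeg; omega
  have hlc : χK.coeff δ ≠ 0 := by
    rw [← hχKdeg, coeff_natDegree]
    exact leadingCoeff_ne_zero.2 hχK0
  have hres0 : resultant χK hK' δ hK'.natDegree = 0 :=
    (mul_eq_zero.1 hmap).resolve_left (pow_ne_zero _ hlc)
  rw [← hχKdeg] at hres0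
  have hncop : ¬ IsCoprime χK hK' := (resultant_eq_zero_iff.1 hres0).2
  have hirrK : Irreducible χK := irreducible_map_fractionRing_of_isUnit_leadingCoeff hχirr hχu
  have hdvdK : χK ∣ hK' := by
    by_contra hnd
    exact hncop (hirrK.coprime_iff_not_dvd.2 hnd)
  have := natDegree_le_of_dvd hdvdK hK0
  omega

/-- The sum of the elements of a `c`-element set of naturals `< N` is at most
`(N − 1) + (N − 2) + ⋯ + (N − c)`. [folklore] -/
theorem sum_le_of_subset_range {c N : ℕ} (S : Finset ℕ) (hS : S ⊆ Finset.range N)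
    (hc : S.card = c) : ∑ s ∈ S, s ≤ ∑ i ∈ Finset.range c, (N - 1 - i) := by
  induction c generalizing S N with
  | zero => simp [Finset.card_eq_zero.mp hc]
  | succ c ih =>
    have hne : S.Nonempty := Finset.card_pos.mp (by omega)
    set m := S.max' hne with hm
    have hmS : m ∈ S := Finset.max'_mem S hne
    have hmN : m < N := Finset.mem_range.mp (hS hmS)
    have hsub : S.erase m ⊆ Finset.range m := fun x hx => by
      rw [Finset.mem_range]
      obtain ⟨hxm, hxS⟩ := Finset.mem_erase.mp hx
      exact lt_of_le_of_ne (Finset.le_max' S x hxS) hxm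
    have hcard : (S.erase m).card = c := by rw [Finset.card_erase_of_mem hmS, hc]; rfl
    have h1 := ih (S.erase m) hsub hcard
    rw [← Finset.add_sum_erase S _ hmS, Finset.sum_range_succ']
    have h2 : ∑ i ∈ Finset.range c, (m - 1 - i) ≤ ∑ i ∈ Finset.range c, (N - 1 - (i + 1)) :=
      Finset.sum_le_sum fun i _ => by omega
    omega

/-- The row indices of an injective choice of `c` rows among `N` sum to at most
`(N − 1) + ⋯ + (N − c)`. [folklore] -/
theorem sum_val_le_of_injective {ι : Type*} [Fintype ι] {N : ℕ} (f : ι → Fin N)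
    (hf : Function.Injective f) :
    ∑ i, (f i : ℕ) ≤ ∑ i ∈ Finset.range (Fintype.card ι), (N - 1 - i) := by
  classical
  have hinj : Function.Injective fun i => (f i : ℕ) := fun i j h => hf (Fin.ext h)
  have hsum : ∑ i, (f i : ℕ) = ∑ s ∈ Finset.univ.image (fun i => (f i : ℕ)), s := by
    rw [Finset.sum_image fun i _ j _ h => hinj h]
  rw [hsum]
  refine sum_le_of_subset_range _ (fun s hs => ?_) ?_
  · obtain ⟨i, -, rfl⟩ := Finset.mem_image.mp hs
    exact Finset.mem_range.mpr (f i).isLt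
  · rw [Finset.card_image_of_injective _ hinj, Finset.card_univ]

/-- `2 ∑_{i<c} (ℓ − i) + c(c − 1) = 2cℓ` for `c ≤ ℓ + 1`. [folklore] -/
theorem two_mul_sum_range_sub (ℓ : ℕ) : ∀ c, c ≤ ℓ + 1 →
    2 * ∑ i ∈ Finset.range c, (ℓ - i) + c * (c - 1) = 2 * c * ℓ := by
  intro c
  induction c with
  | zero => simp
  | succ c ih =>
    intro hc
    rw [Finset.sum_range_succ, mul_add, show (c + 1) * (c + 1 - 1) = c * (c - 1) + 2 * c by
      cases c with
      | zero => simp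
      | succ c => simp; ring]
    have := ih (by omega)
    have hsub : ℓ - c + c = ℓ := Nat.sub_add_cancel (by omega)
    nlinarith [this, hsub]

/-- **Kaltofen's degree count** `∑_{j=0}^{d²−1} (ℓ_max − j) = 3d⁴/2 − 2d³ + d²/2` with
`ℓ_max = 2d(d − 1)`, in the cleared form. [cite: Kaltofen1995, §4, proof of Thm. 5] -/
theorem kaltofen_degree_count (δ : ℕ) :
    2 * ∑ i ∈ Finset.range (δ ^ 2), (2 * δ * (δ - 1) - i) + 4 * δ ^ 3 = 3 * δ ^ 4 + δ ^ 2 := by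
  rcases Nat.eq_zero_or_pos δ with rfl | hδ
  · simp
  obtain ⟨t, rfl⟩ : ∃ t, δ = t + 1 := ⟨δ - 1, by omega⟩
  have ht : t + 1 - 1 = t := Nat.add_sub_cancel t 1
  rw [ht]
  have hle : (t + 1) ^ 2 ≤ 2 * (t + 1) * t + 1 := by nlinarith
  have key := two_mul_sum_range_sub (2 * (t + 1) * t) ((t + 1) ^ 2) hle
  rw [show (t + 1) ^ 2 - 1 = t ^ 2 + 2 * t by
    rw [show (t + 1) ^ 2 = t ^ 2 + 2 * t + 1 by ring, Nat.add_sub_cancel]] at key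
  zify at key ⊢
  linear_combination key

/-- **Kaltofen 1995, Theorem 5, with the printed degree bound** — the sharp form of
`exists_irreducibility_certificate` (`BertiniSpecializationProofs`, whose bound is
`δ²(2δ² − δ)`). Let `χ ∈ E[Z][Y][X]` be irreducible of `X`-degree `δ ≥ 1` with leading coefficient
the non-zero constant `c`, of total degree `≤ δ` in `(X, Y)`, with the coefficient of `Xᵉ Yʲ` of
`Z`-degree `≤ j`, and with `χ(X, 0, Z) = g(X)` for a `g ∈ E[X]` having a simple root `α ∈ E`.
Then there is `Ψ ∈ E[Z]`, `Ψ ≠ 0`, with `2 deg Ψ + 4δ³ ≤ 3δ⁴ + δ²` (i.e.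
`deg Ψ ≤ 3δ⁴/2 − 2δ³ + δ²/2 = ∑_{j<δ²} (2δ(δ−1) − j)`), such that `χ(X, Y, γ) ∈ E[Y][X]` is
irreducible whenever `Ψ(γ) ≠ 0`. The two refinements over the sibling proof are Kaltofen's:
the order of approximation `ℓ = 2δ(δ − 1)` (the resultant `Res_X(χ, h)` has `Y`-degree
`≤ (δ−1)·δ + δ·(δ−1)`, `eq_zero_of_pow_dvd_eval₂`), and the degree of a maximal minor as the sum
of DISTINCT row indices (`sum_val_le_of_injective`). [cite: Kaltofen1995, §4 Thm. 5] -/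
theorem exists_irreducibility_certificate_sharp {E : Type*} [Field E] {n : ℕ}
    {χ : Polynomial (Polynomial (MvPolynomial (Fin n) E))}
    {δ : ℕ} (hδ : 1 ≤ δ) (hdeg : χ.natDegree = δ) {c : E} (hc : c ≠ 0)
    (hlead : χ.leadingCoeff = Polynomial.C (MvPolynomial.C c)) (hirr : Irreducible χ)
    (htd : ∀ e j, δ < j + e → (χ.coeff e).coeff j = 0)
    (hfil : ∀ e j, ((χ.coeff e).coeff j).totalDegree ≤ j)
    {g : E[X]}
    (hred : χ.map (evalRingHom 0) = g.map (MvPolynomial.C : E →+* MvPolynomial (Fin n) E))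
    {α : E} (hα : g.eval α = 0) (hα' : (derivative g).eval α ≠ 0) :
    ∃ Ψ : MvPolynomial (Fin n) E, Ψ ≠ 0 ∧ 2 * Ψ.totalDegree + 4 * δ ^ 3 ≤ 3 * δ ^ 4 + δ ^ 2 ∧
      ∀ γ : Fin n → E, MvPolynomial.eval γ Ψ ≠ 0 →
        Irreducible (χ.map (mapRingHom (MvPolynomial.eval γ))) := by
  classical
  set κ : ℕ := 2 * δ * (δ - 1) + 1 with hκ
  -- consequences of the shape hypotheses
  have hχc : ∀ i, (χ.coeff i).natDegree ≤ δ := fun i => by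
    rw [natDegree_le_iff_coeff_eq_zero]
    intro j hj
    exact htd i j (by omega)
  have hχu : IsUnit χ.leadingCoeff := by
    rw [hlead]
    exact Polynomial.isUnit_C.2 ((IsUnit.mk0 c hc).map MvPolynomial.C)
  -- Step 1: a truncated root by Newton–Hensel lifting, inside the degree filtration
  set u : E := ((derivative g).eval α)⁻¹ with hu
  have hroot0 : (X : Polynomial (MvPolynomial (Fin n) E)) ∣
      χ.eval (Polynomial.C (MvPolynomial.C α)) := by
    refine X_dvd_eval_C_of_eval_eq_zero χ ?_
    rw [hred, eval_map, eval₂_at_apply, hα, map_zero]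
  have hunit0 : (X : Polynomial (MvPolynomial (Fin n) E)) ∣
      1 - Polynomial.C (MvPolynomial.C u) * (derivative χ).eval (Polynomial.C (MvPolynomial.C α)) := by
    refine X_dvd_one_sub_of_eval_derivative χ ?_
    rw [hred, derivative_map, eval_map, eval₂_at_apply, ← map_mul, hu, inv_mul_cancel₀ hα', map_one]
  obtain ⟨a, haS, -, haroot⟩ := exists_approxRoot_of_invariant χ (MvPolynomial.C α)
    (MvPolynomial.C u) {a | ∀ j, (a.coeff j).totalDegree ≤ j} (filtrationY_C_C α)
    (fun a ha => filtrationY_newton_step hfil u ha) hroot0 hunit0 (2 * κ - 1)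
  rw [show 2 * κ - 1 + 1 = 2 * κ by omega] at haroot
  have haS' : ∀ j, (a.coeff j).totalDegree ≤ j := haS
  have haroot' : (X : Polynomial (MvPolynomial (Fin n) E)) ^ κ ∣ χ.eval a :=
    (pow_dvd_pow _ (by omega)).trans haroot
  -- Step 2: the matrix of `w ↦ (h_w(a))_{k<κ}` has independent columns
  set M : Matrix (Fin κ) (Fin δ × Fin δ) (MvPolynomial (Fin n) E) :=
    Matrix.of fun k p => (X ^ (p.2 : ℕ) * a ^ (p.1 : ℕ)).coeff k with hM
  have hcols : LinearIndependent (MvPolynomial (Fin n) E) M.col := by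
    rw [Fintype.linearIndependent_iff]
    intro w hw p
    set h : Polynomial (Polynomial (MvPolynomial (Fin n) E)) :=
      ∑ e' : Fin δ, Polynomial.C (∑ j' : Fin δ, Polynomial.C (w (e', j')) * X ^ (j' : ℕ)) *
        X ^ (e' : ℕ) with hh
    have hk : ∀ k : Fin κ, (h.eval a).coeff k = 0 := fun k => by
      rw [hh, coeff_eval_small]
      have := congrFun hw k
      simp only [Finset.sum_apply, Pi.smul_apply, smul_eq_mul, Pi.zero_apply, Matrix.col_apply,
        hM, Matrix.of_apply] at this
      rw [← this]
    have hdvd : (X : Polynomial (MvPolynomial (Fin n) E)) ^ κ ∣ h.eval a := by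
      rw [X_pow_dvd_iff]
      intro d hd
      exact hk ⟨d, hd⟩
    have h0 : h = 0 :=
      eq_zero_of_pow_dvd_eval₂ (δ := δ) (d₁ := δ) (d₂ := δ - 1) (κ := κ) hδ hdeg hχu hirr hχc
        (natDegree_sum_C_mul_X_pow_le _ hδ)
        (fun i => natDegree_coeff_small_le w hδ i)
        (by rw [hκ, show δ * (δ - 1) + (δ - 1) * δ = 2 * δ * (δ - 1) by ring]; exact Nat.lt_succ_self _)
        haroot' hdvd
    have := coeff_coeff_small w p.1 p.2
    rw [← hh, h0, coeff_zero, coeff_zero] at this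
    exact this.symm
  -- Step 3: degrees of the entries and a nonzero maximal minor
  have hMdeg : ∀ k p, (M k p).totalDegree ≤ (k : ℕ) := by
    intro k p
    rw [hM, Matrix.of_apply, coeff_X_pow_mul']
    split_ifs with hle
    · exact (filtrationY_pow haS' _ _).trans (Nat.sub_le _ _)
    · rw [MvPolynomial.totalDegree_zero]; exact Nat.zero_le _
  obtain ⟨f, hf, hdet⟩ := exists_det_submatrix_ne_zero M hcols
  have hdet' : (M.submatrix f id).det ≠ 0 := by convert hdet
  have hdegΨ : 2 * (M.submatrix f id).det.totalDegree + 4 * δ ^ 3 ≤ 3 * δ ^ 4 + δ ^ 2 := by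
    have h1 : (M.submatrix f id).det.totalDegree ≤ ∑ j, (f j : ℕ) :=
      isSubdegree_totalDegree.det_le (M.submatrix f id) (fun j => (f j : ℕ)) fun i j => by
        rw [Matrix.submatrix_apply]; exact hMdeg (f i) j
    have h2 := sum_val_le_of_injective f hf
    have hκ1 : κ - 1 = 2 * δ * (δ - 1) := by rw [hκ]; exact Nat.add_sub_cancel _ _
    have hcard : Fintype.card (Fin δ × Fin δ) = δ ^ 2 := by
      rw [Fintype.card_prod, Fintype.card_fin, pow_two]
    rw [hcard, hκ1] at h2
    have h3 := kaltofen_degree_count δ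
    omega
  refine ⟨(M.submatrix f id).det, hdet', hdegΨ, fun γ hγ => ?_⟩
  -- Step 4: specialisation at `γ` with `Ψ(γ) ≠ 0`
  set φ : MvPolynomial (Fin n) E →+* E := MvPolynomial.eval γ with hφ
  set χ₀ : E[X][X] := χ.map (mapRingHom φ) with hχ₀
  set a₀ : E[X] := a.map φ with ha₀
  have hlc : (mapRingHom φ) χ.leadingCoeff = Polynomial.C c := by
    rw [hlead, coe_mapRingHom, Polynomial.map_C, hφ, MvPolynomial.eval_C]
  have hlc0 : (mapRingHom φ) χ.leadingCoeff ≠ 0 := by rw [hlc]; exact Polynomial.C_ne_zero.2 hc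
  have hdeg0 : χ₀.natDegree = δ := by
    rw [hχ₀, natDegree_map_of_leadingCoeff_ne_zero _ hlc0, hdeg]
  have hlead0 : χ₀.leadingCoeff = Polynomial.C c := by
    rw [hχ₀, leadingCoeff_map_of_leadingCoeff_ne_zero _ hlc0, hlc]
  have htd0 : ∀ e j, δ < j + e → (χ₀.coeff e).coeff j = 0 := fun e j hej => by
    rw [hχ₀, coeff_map, coe_mapRingHom, coeff_map, htd e j hej, map_zero]
  have hroot0' : (X : E[X]) ^ (2 * κ) ∣ χ₀.eval a₀ := by
    have := map_dvd (mapRingHom φ) haroot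
    rw [coe_mapRingHom, Polynomial.map_pow, map_X, ← map_mapRingHom_eval_map] at this
    exact this
  refine irreducible_of_noSmallAnnihilator hδ hdeg0 hc hlead0 htd0 hroot0' ?_
  intro P hPdeg hPc hPdvd
  set w₀ : Fin δ × Fin δ → E := fun p => (P.coeff p.1).coeff p.2 with hw₀
  have hP : P = ∑ e' : Fin δ, Polynomial.C (∑ j' : Fin δ, Polynomial.C (w₀ (e', j')) *
      X ^ (j' : ℕ)) * X ^ (e' : ℕ) :=
    eq_small_of_natDegree_le hδ hPdeg hPc
  have hentry : ∀ (k : ℕ) (p : Fin δ × Fin δ),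
      (X ^ (p.2 : ℕ) * a₀ ^ (p.1 : ℕ) : E[X]).coeff k =
        φ ((X ^ (p.2 : ℕ) * a ^ (p.1 : ℕ)).coeff k) := by
    intro k p
    rw [← coeff_map, Polynomial.map_mul, Polynomial.map_pow, Polynomial.map_pow, map_X]
  have hmul : ((M.submatrix f id).map φ).mulVec w₀ = 0 := by
    funext i
    rw [Matrix.mulVec, Pi.zero_apply, dotProduct]
    have hk : (P.eval a₀).coeff (f i) = 0 := by
      rw [X_pow_dvd_iff] at hPdvd
      exact hPdvd _ (f i).2
    rw [hP, coeff_eval_small] at hk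
    rw [← hk]
    refine Finset.sum_congr rfl fun p _ => ?_
    rw [Matrix.map_apply, Matrix.submatrix_apply, hM, Matrix.of_apply, id, hentry, mul_comm]
  have hdet0 : ((M.submatrix f id).map φ).det ≠ 0 := by
    rw [← RingHom.mapMatrix_apply, ← RingHom.map_det]
    exact hγ
  have hw0 : w₀ = 0 := Matrix.eq_zero_of_mulVec_eq_zero hdet0 hmul
  rw [hP, hw0]
  simp

end SharpCertificate

/-! ### From Kaltofen's/Cafure–Matera's parametrisation to `planeSection` -/

section Transport

open Polynomial
open Literature.NumberTheory.DiophantineGeometry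
open Literature.RingTheory.NoetherNormalization (linearChange linearChangeEquiv
  linearChangeEquiv_apply)

/-- **A non-zero certificate in one variable fewer.** For `0 ≠ p ∈ E[Z₀, …, Zₘ]` over an infinite
field, the leading `Z₀`-coefficient `Ψ ∈ E[Z₁, …, Zₘ]` is non-zero, `deg Ψ ≤ deg p`, and wherever
`Ψ(η) ≠ 0` some value `Z₀ = γ₀` gives `p(γ₀, η) ≠ 0`. [folklore] -/
theorem exists_coeff_certificate {E : Type*} [Field E] [Infinite E] {m : ℕ}
    {p : MvPolynomial (Fin (m + 1)) E} (hp : p ≠ 0) :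
    ∃ Ψ : MvPolynomial (Fin m) E, Ψ ≠ 0 ∧ Ψ.totalDegree ≤ p.totalDegree ∧
      ∀ η : Fin m → E, MvPolynomial.eval η Ψ ≠ 0 →
        ∃ γ₀ : E, MvPolynomial.eval (Fin.cons γ₀ η : Fin (m + 1) → E) p ≠ 0 := by
  classical
  set P := MvPolynomial.finSuccEquiv E m p with hP
  have hP0 : P ≠ 0 := by
    rw [hP]; exact (EmbeddingLike.map_ne_zero_iff).2 hp
  have hlc : P.leadingCoeff ≠ 0 := leadingCoeff_ne_zero.2 hP0
  refine ⟨P.leadingCoeff, hlc, ?_, fun η hη => ?_⟩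
  · have := MvPolynomial.totalDegree_coeff_finSuccEquiv_add_le p P.natDegree
      (by rw [← hP]; exact hlc)
    rw [← hP] at this
    exact (Nat.le_add_right _ _).trans this
  · set q := P.map (MvPolynomial.eval η) with hq
    have hq0 : q ≠ 0 := by
      intro h0
      apply hη
      have := congrArg (fun r : E[X] => r.coeff P.natDegree) h0
      simpa [hq, Polynomial.coeff_map] using this
    obtain ⟨γ₀, hγ₀⟩ := Infinite.exists_notMem_finset q.roots.toFinset
    refine ⟨γ₀, fun h0 => hγ₀ ?_⟩
    rw [MvPolynomial.eval_eq_eval_mv_eval', ← hP, ← hq] at h0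
    exact Multiset.mem_toFinset.2 ((Polynomial.mem_roots hq0).2 h0)

/-- Evaluating the sheared polynomial `p(Z₀, Z₁ + ω₁Z₀, …)`. [folklore] -/
theorem eval_linearChange {E : Type*} [CommRing E] {m : ℕ} (ω : Fin m → E)
    (x : Fin (m + 1) → E) (p : MvPolynomial (Fin (m + 1)) E) :
    MvPolynomial.eval x (linearChange ω p) =
      MvPolynomial.eval (Fin.cons (x 0) fun i => x i.succ + ω i * x 0 : Fin (m + 1) → E) p := by
  change MvPolynomial.aeval x (linearChange ω p) =
    MvPolynomial.aeval (Fin.cons (x 0) fun i => x i.succ + ω i * x 0 : Fin (m + 1) → E) p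
  rw [linearChange, MvPolynomial.comp_aeval_apply]
  have hfun : (fun i => MvPolynomial.aeval x ((Fin.cons (MvPolynomial.X 0)
      (fun i => MvPolynomial.X i.succ + MvPolynomial.C (ω i) * MvPolynomial.X 0) :
        Fin (m + 1) → MvPolynomial (Fin (m + 1)) E) i)) =
      (Fin.cons (x 0) fun i => x i.succ + ω i * x 0 : Fin (m + 1) → E) := by
    funext i
    refine Fin.cases ?_ (fun j => ?_) i <;> simp [mul_comm]
  rw [hfun]

/-- The shear does not raise the total degree. [folklore] -/
theorem totalDegree_linearChange_le {E : Type*} [CommRing E] [Nontrivial E] {m : ℕ}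
    (ω : Fin m → E) (p : MvPolynomial (Fin (m + 1)) E) :
    (linearChange ω p).totalDegree ≤ p.totalDegree := by
  refine totalDegree_aeval_le_of_forall_le_one _ (fun i => ?_) p
  refine Fin.cases ?_ (fun j => ?_) i
  · rw [Fin.cons_zero]; exact (MvPolynomial.totalDegree_X _).le
  · rw [Fin.cons_succ]
    refine (MvPolynomial.totalDegree_add _ _).trans
      (max_le (MvPolynomial.totalDegree_X _).le ?_)
    refine (MvPolynomial.totalDegree_mul _ _).trans ?_
    rw [MvPolynomial.totalDegree_C, zero_add]
    exact (MvPolynomial.totalDegree_X _).le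

variable {K : Type*} [Field K] {n : ℕ}

/-- **The plane section with a sheared `x₀` is an affine image of `planeSection`.** For
`γ = (γ₀, η + γ₀ω)`, the specialisation `f(ν₀ + X + γ₀Y, νᵢ + ωᵢX + γᵢY)` of the plane section
in Cafure–Matera's parametrisation (direction `(1, ω)`, all `n + 1` coordinates sheared by `Y·γ`)
becomes `planeSection f ν ω η = f(X + ν₀, ωᵢX + ηᵢY + νᵢ)` after the substitution
`X ↦ X − γ₀Y` and the identification `K̄[Y][X] ≅ K̄[X₀, X₁]`. [folklore] -/
theorem transport_planeSection (f : MvPolynomial (Fin (n + 1)) K) {E : Type*} [Field E]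
    [Algebra K E] (ν : Fin (n + 1) → E) (ω η : Fin n → E) (γ₀ : E) :
    ((Polynomial.Bivariate.equivMvPolynomial E).trans
        (MvPolynomial.renameEquiv E (Equiv.swap (0 : Fin 2) 1)))
      ((Polynomial.algEquivAevalXAddC (-(Polynomial.C γ₀ * Polynomial.X) : E[X]))
        ((MvPolynomial.aeval (fun i =>
          (Polynomial.C (Polynomial.C (MvPolynomial.C (ν i))) +
            Polynomial.C (Polynomial.C (MvPolynomial.C ((Fin.cons 1 ω : Fin (n + 1) → E) i))) *
              Polynomial.X +
            Polynomial.C (Polynomial.C (MvPolynomial.X i) * Polynomial.X) :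
              Polynomial (Polynomial (MvPolynomial (Fin (n + 1)) E))))
          (MvPolynomial.map (algebraMap K E) f)).map
          (mapRingHom (MvPolynomial.eval
            (Fin.cons γ₀ (fun i => η i + ω i * γ₀) : Fin (n + 1) → E))))) =
      planeSection f ν ω η := by
  set ε := (Polynomial.Bivariate.equivMvPolynomial E).trans
    (MvPolynomial.renameEquiv E (Equiv.swap (0 : Fin 2) 1)) with hε
  set S := Polynomial.algEquivAevalXAddC (-(Polynomial.C γ₀ * Polynomial.X) : E[X]) with hS
  set γ : Fin (n + 1) → E := Fin.cons γ₀ fun i => η i + ω i * γ₀ with hγ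
  set gens : Fin (n + 1) → Polynomial (Polynomial (MvPolynomial (Fin (n + 1)) E)) := fun i =>
    Polynomial.C (Polynomial.C (MvPolynomial.C (ν i))) +
      Polynomial.C (Polynomial.C (MvPolynomial.C ((Fin.cons 1 ω : Fin (n + 1) → E) i))) *
        Polynomial.X +
      Polynomial.C (Polynomial.C (MvPolynomial.X i) * Polynomial.X) with hgens
  -- both sides are ring homomorphisms applied to `f`; compare them on generators
  have hΦ : ((ε : Polynomial (Polynomial E) →+* MvPolynomial (Fin 2) E).comp
      (((S : Polynomial (Polynomial E) →+* Polynomial (Polynomial E)).comp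
        ((mapRingHom (mapRingHom (MvPolynomial.eval γ))).comp
          ((MvPolynomial.aeval (R := E) gens).toRingHom.comp
            (MvPolynomial.map (algebraMap K E))))))) =
      (MvPolynomial.aeval (R := K) (Fin.cases (MvPolynomial.X 0 + MvPolynomial.C (ν 0))
        (fun i : Fin n => MvPolynomial.C (ω i) * MvPolynomial.X 0 +
          MvPolynomial.C (η i) * MvPolynomial.X 1 + MvPolynomial.C (ν i.succ)) :
            Fin (n + 1) → MvPolynomial (Fin 2) E)).toRingHom := by
    have hεCC : ∀ a : E, ε (Polynomial.C (Polynomial.C a)) = MvPolynomial.C a := fun a => by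
      simp [ε]
    have hεCX : ε (Polynomial.C Polynomial.X) = MvPolynomial.X 1 := by
      simp [ε]
    have hεX : ε Polynomial.X = MvPolynomial.X 0 := by
      simp [ε]
    have hSC : ∀ r : E[X], S (Polynomial.C r) = Polynomial.C r := fun r => by
      simp [S]
    have hSX : S Polynomial.X = Polynomial.X + Polynomial.C (-(Polynomial.C γ₀ * Polynomial.X)) := by
      simp [S]
    -- stage 1–3 on a generator: base change, substitution, specialisation at `γ`
    have h3 : ∀ j : Fin (n + 1), ((mapRingHom (mapRingHom (MvPolynomial.eval γ))).comp
        ((MvPolynomial.aeval (R := E) gens).toRingHom.comp (MvPolynomial.map (algebraMap K E))))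
          (MvPolynomial.X j) =
        Polynomial.C (Polynomial.C (ν j)) +
          Polynomial.C (Polynomial.C ((Fin.cons 1 ω : Fin (n + 1) → E) j)) * Polynomial.X +
          Polynomial.C (Polynomial.C (γ j) * Polynomial.X) := fun j => by
      simp [gens]
    have h3c : ∀ c : K, ((mapRingHom (mapRingHom (MvPolynomial.eval γ))).comp
        ((MvPolynomial.aeval (R := E) gens).toRingHom.comp (MvPolynomial.map (algebraMap K E))))
          (MvPolynomial.C c) = Polynomial.C (Polynomial.C (algebraMap K E c)) := fun c => by
      simp [Polynomial.algebraMap_apply, MvPolynomial.algebraMap_eq]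
    refine MvPolynomial.ringHom_ext (fun c => ?_) (fun j => ?_)
    · rw [RingHom.comp_apply, RingHom.comp_apply, h3c]
      simp only [RingHom.coe_coe, hSC, hεCC, AlgHom.toRingHom_eq_coe, MvPolynomial.algHom_C,
        MvPolynomial.algebraMap_apply]
    · rw [RingHom.comp_apply, RingHom.comp_apply, h3 j]
      simp only [RingHom.coe_coe, map_add, map_mul, map_neg, hSC, hSX, hεCC, hεX, hεCX,
        AlgHom.toRingHom_eq_coe, MvPolynomial.aeval_X]
      refine Fin.cases ?_ (fun i => ?_) j
      · simp only [Fin.cons_zero, Fin.cases_zero, hγ, map_one]; ring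
      · simp only [Fin.cons_succ, Fin.cases_succ, hγ, map_add, map_mul]; ring
  have := congrArg (fun φ : MvPolynomial (Fin (n + 1)) K →+* MvPolynomial (Fin 2) E => φ f) hΦ
  simpa [planeSection] using this

end Transport

/-! ### Theorem 5 for the sections `planeSection f ν ω η` and the fact -/

section Final

open Polynomial
open Literature.NumberTheory.DiophantineGeometry
open Literature.RingTheory.NoetherNormalization (linearChange linearChangeEquiv
  linearChangeEquiv_apply)

universe u

/-- **Kaltofen 1995, Theorem 5** for the sections `planeSection f ν ω η`: if the line restriction
`f(X + ν₀, ω₁X + ν₁, …)` has degree `δ = deg f` and is separable (condition (33)), then some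
non-zero `Ψ ∈ K̄[z₁, …, zₙ]` with `2 deg Ψ + 4δ³ ≤ 3δ⁴ + δ²` certifies irreducibility of
`f(X + ν₀, ω₁X + η₁Y + ν₁, …, ωₙX + ηₙY + νₙ) ∈ K̄[X, Y]` whenever `Ψ(η) ≠ 0`. Proof: the sharp
certificate `Ψ'` (`exists_irreducibility_certificate_sharp`) of the plane section through the line
`ν + X(1, ω)` with all `n + 1` coordinates sheared (`f(ν₀ + X + z₀Y, νᵢ + ωᵢX + zᵢY)`,
`irreducible_planeSubst` and the shape lemmas of `BertiniShapeProofs`); `Ψ` is the leading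
`z₀`-coefficient of `Ψ'(z₀, z + ωz₀)`, and `X ↦ X − γ₀Y` turns the certified section into
`planeSection f ν ω η` (`transport_planeSection`). [cite: Kaltofen1995, §4 Thm. 5] -/
theorem kaltofen1995_thm5_fibre (K : Type u) [Field K] {n δ : ℕ}
    (f : MvPolynomial (Fin (n + 1)) K) (hδ : 1 ≤ δ) (hdeg : f.totalDegree = δ)
    (hf : IsAbsIrreducible f) (ν : Fin (n + 1) → AlgebraicClosure K) (ω : Fin n → AlgebraicClosure K)
    (hgdeg : (lineRestrict f ν ω).natDegree = δ) (hgsep : (lineRestrict f ν ω).Separable) :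
    ∃ Ψ : MvPolynomial (Fin n) (AlgebraicClosure K), Ψ ≠ 0 ∧
      2 * Ψ.totalDegree + 4 * δ ^ 3 ≤ 3 * δ ^ 4 + δ ^ 2 ∧
        ∀ η : Fin n → AlgebraicClosure K, MvPolynomial.eval η Ψ ≠ 0 →
          Irreducible (planeSection f ν ω η) := by
  set fb : MvPolynomial (Fin (n + 1)) (AlgebraicClosure K) :=
    MvPolynomial.map (algebraMap K (AlgebraicClosure K)) f with hfb'
  have hfb : Irreducible fb := hf
  have hdegb : fb.totalDegree = δ := by
    rw [hfb', totalDegree_map_of_injective f (algebraMap K (AlgebraicClosure K)).injective, hdeg]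
  set g : (AlgebraicClosure K)[X] := lineRestrict f ν ω with hg
  -- `g` in Cafure–Matera's notation: the restriction of `fb` to the line `ν + X(1, ω)`
  have hgb : MvPolynomial.aeval (fun i => Polynomial.C (ν i) +
      Polynomial.C ((Fin.cons 1 ω : Fin (n + 1) → AlgebraicClosure K) i) * Polynomial.X) fb = g := by
    rw [hg, ← lineRestrict_map (K' := AlgebraicClosure K) f ν ω]; rfl
  have hg0 : g ≠ 0 := fun h0 => by rw [h0, natDegree_zero] at hgdeg; omega
  set c : AlgebraicClosure K := g.coeff δ with hc
  have hc0 : c ≠ 0 := by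
    rw [hc, ← hgdeg, Polynomial.coeff_natDegree]; exact leadingCoeff_ne_zero.2 hg0
  have hc' : MvPolynomial.eval (Fin.cons 1 ω : Fin (n + 1) → AlgebraicClosure K)
      (MvPolynomial.homogeneousComponent δ fb) = c := by
    rw [hc, hg, ← lineRestrict_map (K' := AlgebraicClosure K) f ν ω, ← hfb', ← hdegb,
      coeff_lineRestrict_totalDegree]
    rfl
  -- the plane section with all `n + 1` coordinates sheared
  set χ : Polynomial (Polynomial (MvPolynomial (Fin (n + 1)) (AlgebraicClosure K))) :=
    MvPolynomial.aeval (fun i =>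
      (Polynomial.C (Polynomial.C (MvPolynomial.C (ν i))) +
        Polynomial.C (Polynomial.C (MvPolynomial.C
          ((Fin.cons 1 ω : Fin (n + 1) → AlgebraicClosure K) i))) * Polynomial.X +
        Polynomial.C (Polynomial.C (MvPolynomial.X i) * Polynomial.X) :
          Polynomial (Polynomial (MvPolynomial (Fin (n + 1)) (AlgebraicClosure K))))) fb with hχ
  -- its shape (`BertiniShapeProofs`, `BertiniSubstitutionProofs`)
  have hcoeff : χ.coeff δ = Polynomial.C (MvPolynomial.C c) := by
    rw [hχ, ← hdegb, coeff_planeSubst_totalDegree, hdegb, hc']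
  have hχdeg : χ.natDegree = δ := by
    refine le_antisymm ?_ (le_natDegree_of_ne_zero ?_)
    · rw [hχ, ← hdegb]; exact natDegree_planeSubst_le fb ν _
    · rw [hcoeff]
      exact Polynomial.C_ne_zero.2 (MvPolynomial.C_ne_zero.2 hc0)
  have hlead : χ.leadingCoeff = Polynomial.C (MvPolynomial.C c) := by
    rw [Polynomial.leadingCoeff, hχdeg, hcoeff]
  have hirr : Irreducible χ := by
    rw [hχ]
    exact irreducible_planeSubst hfb ν _ (by rw [hgb]; exact hg0)
  have htd : ∀ e j, δ < j + e → (χ.coeff e).coeff j = 0 := by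
    rw [hχ, ← hdegb]; exact coeff_coeff_planeSubst_eq_zero fb ν _
  have hfil : ∀ e j, ((χ.coeff e).coeff j).totalDegree ≤ j := by
    rw [hχ]; exact filtration_planeSubst fb ν _
  have hred : χ.map (evalRingHom 0) =
      g.map (MvPolynomial.C : AlgebraicClosure K →+* MvPolynomial (Fin (n + 1)) (AlgebraicClosure K)) := by
    rw [hχ, map_evalRingHom_zero_planeSubst, hgb]
  -- a simple root of `g` (separable of degree `δ ≥ 1` over the algebraically closed `K̄`)
  obtain ⟨α, hα⟩ : ∃ α, g.IsRoot α := IsAlgClosed.exists_root g (by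
    rw [Polynomial.degree_eq_natDegree hg0, hgdeg]; exact_mod_cast (by omega : δ ≠ 0))
  have hα' : (derivative g).eval α ≠ 0 := by
    intro h0
    obtain ⟨a, b, hab⟩ := hgsep
    have := congrArg (Polynomial.eval α) hab
    rw [eval_add, eval_mul, eval_mul, show eval α g = 0 from hα, h0, mul_zero, mul_zero,
      add_zero, eval_one] at this
    exact zero_ne_one this
  -- Kaltofen's certificate for the sheared section, with the printed degree bound
  obtain ⟨Ψ', hΨ'0, hΨ'deg, hΨ'⟩ := exists_irreducibility_certificate_sharp (n := n + 1) hδ hχdeg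
    hc0 hlead hirr htd hfil hred hα hα'
  -- remove the shear: `Ψ''(z₀, z) = Ψ'(z₀, z + ω z₀)`, `Ψ` its leading `z₀`-coefficient
  set Ψ'' := linearChange ω Ψ' with hΨ''
  have hΨ''0 : Ψ'' ≠ 0 := by
    rw [hΨ'', ← linearChangeEquiv_apply]
    exact (EmbeddingLike.map_ne_zero_iff).2 hΨ'0
  obtain ⟨Ψ, hΨ0, hΨdeg, hΨ⟩ := exists_coeff_certificate hΨ''0
  refine ⟨Ψ, hΨ0, ?_, fun η hη => ?_⟩
  · have := totalDegree_linearChange_le ω Ψ'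
    rw [← hΨ''] at this
    omega
  · obtain ⟨γ₀, hγ₀⟩ := hΨ η hη
    rw [hΨ'', eval_linearChange] at hγ₀
    simp only [Fin.cons_zero, Fin.cons_succ] at hγ₀
    have hirrγ := hΨ' _ hγ₀
    rw [← transport_planeSection f ν ω η γ₀]
    exact (MulEquiv.irreducible_iff _).2 ((MulEquiv.irreducible_iff _).2 hirrγ)

end Final

end Kaltofen1995

open Kaltofen1995 in
/-- **Kaltofen 1995, §4, Lemma 4 + Theorem 5 — the effective first Bertini / Hilbert irreducibility
theorem in the fibrewise form printed there and quoted by Cafure–Matera 2006, §3.2: PROVED.**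
This discharges the named fact `kaltofen1995_effectiveBertini` of
`AbsoluteIrreducibilityReduction.lean`: `Υ` is the resultant of the generic line restriction and
its derivative (`kaltofen1995_lemma4`), and for each `(ν, ω)` with `Υ(ν, ω) ≠ 0` the fibre
certificate `Ψ` comes from `kaltofen1995_thm5_fibre`. [cite: Kaltofen1995, §4 Lemma 4 + Thm. 5] -/
theorem kaltofen1995_effectiveBertini_holds : kaltofen1995_effectiveBertini := by
  intro K _ n δ f hn hδ hdeg hf
  obtain ⟨Υ, hΥ0, hΥdeg, hΥ⟩ := kaltofen1995_lemma4 K n δ f (by omega) hdeg hf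
  refine ⟨Υ, hΥ0, hΥdeg, fun ν ω hνω => ?_⟩
  obtain ⟨hgdeg, hgsep⟩ := hΥ ν ω hνω
  exact kaltofen1995_thm5_fibre K f (by omega) hdeg hf ν ω hgdeg hgsep

end Literature.RingTheory.MvPolynomial
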